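import Mathlib
import HarnessLib
import HarnessLib.Audit
import Summits.KontsevichZagierPeriods.Statement
import Literature.NumberTheory.Transcendental.KZCalculus
import HarnessLib.Audit.Status.Attr

/-!
Route: HardSphereVirial

# Route HardSphereVirial — Boltzmann's arccos(1/3) inside the rules — hard-sphere cluster integrals
as unit-distance volumes; B3, B4 compile, and the pentagon K3 puts Γ(1/15)Γ(2/15)Γ(4/15)Γ(8/15) into
the hard-disc 5-ring

It suffices to show X = VOLUME FORM of Conjecture 1 (the frame shared with route SphericalSchlafli,
same decl): two
integrand-1 representations of one dimension with equal value are KZ-equivalent — "volume is the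
only KZ-invariant of
finite-volume ℚ-semialgebraic sets"; summit ⟹ X since integrand 1 is rational
(`volumeForm_of_summit`, Sketch.lean rc 0),
X ⟹ summit by difference-of-volumes inside the rules (Assembly, the item SphericalSchlafli already
wants). This route (card
hard-sphere-virial-coefficients-are-periods) attacks X on the EUCLIDEAN UNIT-DISTANCE SECTOR:
domains cut out of (ℝ^D)^(k−1)
by the quadrics |x_i − x_j|² = 1 — the Mayer cluster integrals of the hard-sphere gas, V_G = vol{x :
|x_i − x_j| < 1, ij ∈ E(G)},
x_1 = 0, so that −8·B_4 = 3V(C_4) − 6V(◇) + V(K_4) etc. Ranked cruxes: StarFourSphere (the complete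
star of B_4 in D = 3,
value −(356/945)π³ − (73/315)√2π² + (153/70)arccos(1/3)π², Boltzmann 1899 / Nijboer–van Hove 1952,
as a chain),
RingFiveDiscValue (found this session: the 5-ring of hard discs is π⁴ − (67√5/2880)G −
(1315√5/16)π⁴/G, G = Γ(1/15)Γ(2/15)Γ(4/15)Γ(8/15),
the CM period of the unit-pentagon stratum — a nodal quartic K3 — to 87 digits), StarFourDisc
(complete star of B_4 in D = 2,
value π³ − (3√3/2)π² + π), IsotropyFactorisation3 (engine: the overall rotation is ONE rational
change of variables),
RingFiveDiscBeyondPattern (hence the Clisby–McCoy/Urrutia value pattern fails at k = 5: theorem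
target via Chudnovsky),
UnitDistanceKernel (route-choice repair 2026-08-16: the residual of X modulo these chains — the
kernel of the enlarged calculus
KZ^{ud} = rules + the two star relators + the isotropy relators, on volumes; GPC-strength, stated
openly, filed so that the chains
feed `closes` and the target is concluded by the glue item VolumeFormOfKernel).
Lean: `∀ ⦃N : ℕ⦄ (r r' : Literature.NumberTheory.Transcendental.KZ.IntegralRep N), (∀ x ∈ r.domain,
r.integrand x = 1) → (∀ x ∈ r'.domain, r'.integrand x = 1) → r.value = r'.value →
Literature.NumberTheory.Transcendental.KZ.Equivalent r r'`

## Assembly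
The deciding theorem (route-choice repair 2026-08-16) is `closes (hK : UnitDistanceKernel) (h2 :
StarFourSphere)
(h4 : StarFourDisc) (h5 : IsotropyFactorisation3) (hA : Assembly) : KontsevichZagierPeriods := hA
(glue)`, where glue is the
one-line proof of the support item VolumeFormOfKernel (instantiate R := KZ.relations in the kernel
crux; the three relator
hypotheses are then literally the three ranked chains and KZ.Equivalent unfolds to membership in
KZ.relations; Sketch.lean rc 0),
so the target X = VolumeForm is CONCLUDED by an item from cruxes and the ranked chains are links of
the implication, no longer
only the route's ladder. Assembly itself is X ⟹ summit ("difference of volumes", Viu-Sos): given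
IsRational r, r' with equal
values, Newton–Leibniz with the primitive t turns each into a signed difference of integrand-1
subgraph volumes, unit-interval
bands pad both to a common dimension, disjoint translates (rule 2) merge the positive parts, X
identifies the two merged volumes,
and additivity reassembles [r] − [r'] — literally SphericalSchlafli's assembly item (shared by
signature); summit ⟹ X
(`volumeForm_of_summit`) and summit ⟹ UnitDistanceKernel (`unitDistanceKernel_of_summit`) are
checked in Sketch.lean, so a
refutation of the kernel crux is a counterexample to Conjecture 1, never a route-local event.
RingFiveDiscValue,
RingFiveDiscBeyondPattern, NotUrrutiaDiscs (the k = 5 switch) and the support calibrations stay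
outside the implication by design:
they are value theorems / evidence about the value ring, not relators.

Rationale: WHY THIS LINE. For hard spheres the Mayer function is −𝟙(|r| < 1), so every cluster integral of B_k
is ± the VOLUME of a bounded
ℚ-semialgebraic set cut out by unit-distance quadrics (MontrollMayer1941, ReeHoover1964): a corpus
of integrand-1 KZ-rational
representations maintained by statistical mechanics since 1899, with certified closed forms through
k = 4 in every dimension
(NijboerVanhove1952; ClisbyMccoy2004 even D: ℚ + ℚ√3/π + ℚ/π²; Lyberg2005 odd D: ℚ + ℚ√2/π +
ℚ·arccos(1/3)/π; Urrutia2022)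
and only numerics beyond (Kratky1976, ClisbyMccoy2005). The dictionary imported from algebraic
geometry: the strata of the
quadric arrangement are realization spaces of UNIT-DISTANCE LINKAGES; through k = 4 they are
iterated sphere bundles over the
unit simplex (equilateral triangle ⇒ √3, regular tetrahedron ⇒ √2 and the dihedral angle arccos(1/3)
= Boltzmann's constant),
so the pair motives are mixed Artin–Tate and the printed value rings are explained term by term; at
k = 5, D = 2 the new
stratum is the planar unit pentagon, whose complexification {e₁(t) = 0, e₄(t) = 0} ⊂ ℙ⁴ (edge
vectors in a null coordinate)
is a quartic surface with exactly ten nodes (computed this session, item PentagonNodes), i.e. a K3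
surface, the same CM object
behind p₄(1) = √5·Γ(1/15)Γ(2/15)Γ(4/15)Γ(8/15)/(40π⁴) for the planar 4-step uniform random walk
(BorweinEtAl2012, Borwein2016
eq. (31); checked to 50 digits in kit job j000354) — and the hard-disc ring diagrams ARE such Bessel
moments,
V(C_k) = (2π)^(k−1)∫₀^∞ J₁(t)^k t^(1−k) dt (disc-uniform planar steps have the characteristic
function of unit steps in ℝ⁴,
BorweinStraubVignat2016); the prediction was CONFIRMED within the session: 87-digit PSLQ gives the
sparse identity
V(C_5) = π⁴ − (67/72)π⁴ρ − (1315/128)/ρ, ρ = p₄(1) (crux RingFiveDiscValue), so the Tate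
extrapolation printed as Urrutia's
Conjecture 1 fails diagram-wise at k = 5, D = 2. Imported areas: Mayer/Ree–Hoover cluster theory
(statistical mechanics), polygon/linkage spaces
and motives of quadric arrangements (HausmannKnutson1998, arXiv:math/9803150, DeligneGoncharov2005),
Bessel moments of
short random walks (analytic number theory). No prior route or negative of this summit touches
configuration-space volumes:
KinematicFormulas stops at one-body valuations (B_2, B_3 are kinematic, B_4 is not),
SphericalSchlafli is the spherical
sector, PhiFourLaboratory's graph hypersurfaces have integrand 1/ψ², not 1.

RANKED CRUXES. #0 VolumeForm (target) — X — two integrand-1 integral representations of one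
dimension N with equal value are KZ-equivalent (volume is the only KZ-invariant of finite-volume
ℚ-semialgebraic sets); summit-equivalent frame, here attacked on the Euclidean unit-distance sector.
Identical to SphericalSchlafli.VolumeForm (shared item). (why it might fail: Summit-equivalent, so
every strength barrier applies: false iff an additive invariant of the four move sets refines volume
on ℚ-semialgebraic sets.) [KontsevichZagier2001, ViuSos2021, CressonViusos2022]
#2 StarFourSphere (crux) — BOLTZMANN'S arccos(1/3) INSIDE THE RULES (card H2, TetraB4). For the
complete-star Mayer diagram of B_4 for hard spheres of diameter 1 in ℝ³ — r = [C_{K4}, 1] ⊂ ℝ⁹,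
C_{K4} = {(x_2,x_3,x_4) : all six |x_i − x_j| < 1, x_1 = 0}, value V = −(356/945)π³ − (73/315)√2·π²
+ (153/70)·arccos(1/3)·π² = 11.639… (from Boltzmann/Nijboer–van Hove's B_4/B_2³ = 2707/4480 +
219√2/(2240π) − 4131·arccos(1/3)/(4480π) and the elementary ring/diamond values of RingFourSphere,
DiamondFourSphere; Monte-Carlo 11.51 ± 0.18) — and the representations [√2] = [(0,√2), 1], [θ] = [{0
≤ y₀, y₁² ≤ 8y₀², y₀²+y₁² ≤ 1}, 1] (double sector of half-angle arctan 2√2 = arccos(1/3), area θ),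
[π] = [unit disc, 1]: 1890·[r] + 712·[π]³ + 438·[√2][π]² − 4131·[θ][π]² ∈ KZ.relations. PRODUCT-FREE
TYPING (route-repair 2026-08-15, cylinder convention shared with SphericalSchlafli, so that the
route file imports KZCalculus only): [π]³ is any integrand-1 representation p over disc × disc ×
disc ⊂ ℝ⁶ (closed unit discs), [√2][π]² any integrand-1 s over (0,√2) × disc × disc ⊂ ℝ⁵, [θ][π]²
any integrand-1 a over sector × disc × disc ⊂ ℝ⁶ — i.e. KZ.of of the former KZ.IntegralRep.prod
terms (KZProduct.of_mul_of, which provers may still import). Foreseen chain (≈ 60 moves):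
IsotropyFactorisation3 peels [4π]; descend over lens/triple-intersection cells whose fibre volumes
are π·(polynomial) or (semialgebraic)·(dihedral angle) in odd D (Lyberg2005 §3); angular factors are
never integrated out but traded for [disc]/[sector] representations by the half-angle change of
variables (SphericalSchlafli's RationalAngleSquares pattern), arccos kept unfolded as a sector area,
so every Newton–Leibniz primitive is semialgebraic. [deps: IsotropyFactorisation3, RingFourSphere,
DiamondFourSphere] [difficulty: L] (why it might fail: The triple-intersection volume of three unit
balls carries arctan terms in the distances (Rowlinson/Powell): a second transcendental fibre
function before the last descent may force TWO unfoldings and an 11-dim detour; and only k·1890·(…)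
may be reachable (division is not a move).) [Lyberg2005, NijboerVanhove1952, ClisbyMccoy2004,
KontsevichZagier2001]
#3 RingFiveDiscValue (crux) — THE FIVE-RING OF HARD DISCS IN CLOSED FORM (found this session; card
H4 delivered for one diagram). For the 5-ring Mayer diagram of hard discs, r = [C_{C5}, 1] ⊂ ℝ⁸
(cycle 1-2-3-4-5-1, x_1 = 0): r.value = π⁴ − (67√5/2880)·G − (1315√5/16)·π⁴/G with G =
Γ(1/15)Γ(2/15)Γ(4/15)Γ(8/15); equivalently V(C_5) = π⁴(1 − (67/72)ρ) − (1315/128)/ρ with ρ = p₄(1) =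
√5G/(40π⁴) the Borwein–Straub–Wan–Zudilin density (BorweinEtAl2012; Borwein2016 eq. (31)), i.e.
P(|S_4| < 1) = 1 − (67/72)ρ − (1315/128)/(π⁴ρ) for four disc-uniform planar steps. Evidence: V(C_5)
= 16π⁴∫₀^∞J₁⁵t⁻⁴dt to 90 digits (kit j000494; method exact to 10⁻⁵⁰ on V(C_3), V(C_4)); 87-digit
PSLQ on the 16-element basis {1, ρ, 1/(π⁴ρ)}·{π⁴, √3π³, π², √3π, 1} returns ONLY the sparse relation
−1152V + 1152π⁴ − 1072ρπ⁴ − 11835/ρ = 0 (stable 10⁵ → 10⁶); Tate bases admit none below 10¹². A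
proof should run: disc-uniform steps = unit steps in ℝ⁴ (BorweinStraubVignat2016 dimensional
recursion ν = 1 → ν = 0), modularity of p₄ and Chowla–Selberg for ρ, the W₅ residue relation r₅,₁ =
(13/225)ρ − 2/(5π⁴ρ) (Borwein2016 eq. (32)) for the dual constant. [deps: PentagonNodes]
[difficulty: XL] (why it might fail: It is an 87-digit PSLQ identity, not a theorem: it fails only
'as typed' (a slip in G or the domain) — or if the ν = 1 → ν = 0 Bessel recursion yields rationals
agreeing to 85 digits by accident (probability ~10⁻²³); no proof is assembled anywhere yet.)
[BorweinEtAl2012, Borwein2016, BorweinStraubVignat2016, Urrutia2022, Kratky1976, MontrollMayer1941]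
#4 StarFourDisc (crux) — THE EVEN-DIMENSION ANOMALY COMPILED (card H2, DiscB4). For the complete
star of B_4 for hard discs — r = [C_{K4}, 1] ⊂ ℝ⁶, value V = π³ − (3√3/2)π² + π = 8.5065… (from
Rowlinson/Hemmer's B_4/B_2³ = 2 − 9√3/(2π) + 10/π², ClisbyMccoy2004, and the lens-area values V(C_4)
= π³ − 16π/3, V(◇) = π³ − √3π² − 5π/6 derived this session; Monte-Carlo 8.485 ± 0.030) — and [√3] =
[(0,√3), 1], [π] = [unit disc, 1]: 2·[r] − 2·[π]³ + 3·[√3][π]² − 2·[π] ∈ KZ.relations. PRODUCT-FREE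
TYPING (route-repair 2026-08-15, cylinder convention shared with SphericalSchlafli, so that the
route file imports KZCalculus only): [π]³ is any integrand-1 representation p over disc³ ⊂ ℝ⁶
(closed unit discs), [√3][π]² any integrand-1 s over (0,√3) × disc × disc ⊂ ℝ⁵, [π] any integrand-1
d over the closed unit disc ⊂ ℝ² (= KZ.of of the former KZ.IntegralRep.prod terms by
KZProduct.of_mul_of). Chain: IsotropyFactorisation2 peels [2π]; the fibre AREA of a lens,
2·arccos(ρ/2) − (ρ/2)√(4−ρ²), is transcendental in the distance, so the point x_4 is NOT integrated
out first: instead slice by the distance variables, keep every arccos unfolded as a sector area (one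
extra variable each) and discharge them against the [π] factors by the half-angle change of
variables; √3 enters as the height of the unit equilateral triangle at the boundary stratum ρ = 1 of
the Newton–Leibniz moves. [deps: IsotropyFactorisation2, TriangleDisc] [difficulty: L] (why it might
fail: Three simultaneous arccos fibres (three lenses meeting) must be unfolded at once: the chain
may need dimension 9 and a semialgebraic cell decomposition of the unit-rhombus discriminant; a
bookkeeping failure only shows as 'no chain found', never as a wrong value.) [ClisbyMccoy2004,
Urrutia2022, ReeHoover1964, KontsevichZagier2001]
#5 IsotropyFactorisation3 (crux) — THE ENGINE (card H5, symmetry half). For every ℚ-semialgebraic σ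
⊂ (ℝ³)³ invariant under the diagonal action of O(3) on the three points, [σ, 1] − [ℝ² × τ,
(4/(1+a²+b²)²)·ρ²] ∈ KZ.relations — typed PRODUCT-FREE (route-repair 2026-08-15) as ONE
9-dimensional representation q in the coordinates (a, b, ρ, y_3, y_4), i.e. KZ.of (c.prod t) of the
chart c = [ℝ², 4/(1+a²+b²)²] and the reduced configuration t = [τ, ρ²] (KZProduct.of_mul_of recovers
the factorised reading) — where τ = {(ρ, y_3, y_4) : ρ > 0, ((0,0,ρ), y_3, y_4) ∈ σ} ⊂ ℝ⁷ is the
reduced configuration set and [ℝ², 4/(1+a²+b²)²] (value 4π) is the stereographic chart of S². One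
rational change of variables x_2 = ρ·ω(a,b), x_i = H_ω y_i (H_ω the Householder reflection
exchanging e₃ and ω: rational in (a,b), |det| = 1), Jacobian ρ²·4/(1+a²+b²)², injective off a null
set, then rule 1a for the null sets; in the product-free typing no coordinate permutation /
KZ.IntegralRep.prod bookkeeping is needed. The configuration-space counterpart of KinematicFormulas'
torus shear; every hard-sphere chain starts with it. [difficulty: M] (why it might fail: Only 'as
typed': rule 2 needs HasFDerivWithinAt and injectivity on the whole source, so the Householder pole
ω = e₃ and ρ = 0 must be excised by rule 1a first; if IsSemialgebraicMapOn of the rational chart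
resists Tarski–Seidenberg bookkeeping the engine stalls on library gaps.) [KontsevichZagier2001,
HuberMullerStach2017, Lyberg2005]
#6 RingFiveDiscBeyondPattern (crux) — THE k = 5 SWITCH AGAINST URRUTIA'S PATTERN (card H3,
sharpened). The 5-ring Mayer diagram of hard discs, r = [C_{C5}, 1] ⊂ ℝ⁸, value
36.3645081024898531050030161907958185425… (90 digits, kit j000494), is NOT in ℚπ⁴ + ℚ√3π³ + ℚπ² +
ℚ√3π + ℚ — the per-diagram extrapolation of Clisby–McCoy's even-D theorem for k ≤ 4 and of
Urrutia2022's printed Conjecture 1 (B_5/B_2⁴ = a₀ + a₁√3/π + a₂/π² + a₃√3/π³). Motivic reason: the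
unit-pentagon stratum is a 10-nodal quartic K3 (PentagonNodes) whose H²(−1) survives into H⁸(𝔸⁸,
Q_{C5}) (the other strata are forests: Hodge–Tate, cannot kill a (3,1)-class). Given
RingFiveDiscValue it FOLLOWS from Chudnovsky's algebraic independence of π and the period of a CM
elliptic curve (G = algebraic·π·ω² for CM by ℚ(√−15), Chowla–Selberg): a genuine theorem target, and
the recorded evidence is PSLQ exclusion to height 10¹² at 87 digits. [deps: RingFiveDiscValue,
PentagonNodes] [difficulty: L] (why it might fail: Only if RingFiveDiscValue is a numerical accident
AND the volume class pairs to zero with the K3's transcendental H²: then PSLQ would find a₀..a₄ —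
excluded to height 10¹² at 87 digits, so a refutation needs astronomically large rationals.)
[Urrutia2022, ClisbyMccoy2004, BorweinEtAl2012, Borwein2016, BorweinStraubVignat2016, Kratky1976]
#7 UnitDistanceKernel (crux) — THE RESIDUAL, RELATIVISED (route-choice repair 2026-08-16: operator
hold 'target-unreachable — no item concludes VolumeForm'; route review #2: 'relativise the target à
la AmoebaKernel'). Kernel of the enlarged calculus KZ^{ud} ON VOLUMES: every subgroup R ≥
KZ.relations of KZ.FormalRep that contains the three relator families of the ranked chains written
with ∈ R — Boltzmann's star (StarFourSphere), the disc star (StarFourDisc), the O(3)-isotropy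
relators (IsotropyFactorisation3) — contains KZ.of r − KZ.of r' for every pair of integrand-1
representations of one dimension with equal value ('freshman calculus with Boltzmann's B₄ identities
and rotation-peeling as extra rules has volume as its only invariant'). Honest status (Sketch.lean
rc 0): VolumeForm ⇒ it, summit ⇒ it, and it ∧ the three chains ⇒ VolumeForm (R := KZ.relations, the
glue VolumeFormOfKernel) — GPC-strength exactly like the target, filed so that the engine and the
star chains are load-bearing in `closes` and KZ^{ud} is a formal object on record; ranked last,
refuters read it as VolumeForm. [deps: StarFourSphere, StarFourDisc, IsotropyFactorisation3]
[difficulty: open-problem] (why it might fail: GPC-strength, openly: false iff an additive invariant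
of KZ.FormalRep killing the four move sets — hence the B₄ and isotropy relators, which are theorems
— separates two equal-volume ℚ-semialgebraic sets.) [KontsevichZagier2001, HuberMullerStach2017,
CressonViusos2022, ViuSos2021]
#9 IsotropyFactorisation2 (support) — The plane engine: for O(2)-invariant ℚ-semialgebraic σ ⊂
(ℝ²)³, [σ, 1] − [ℝ × τ, (2/(1+u²))·ρ] ∈ KZ.relations — typed PRODUCT-FREE (route-repair 2026-08-15)
as ONE 6-dimensional representation q in the coordinates (u, ρ, y_3, y_4), = KZ.of (c.prod t) of the
chart c = [ℝ, 2/(1+u²)] (value 2π) and t = [τ, ρ] — with τ = {(ρ, y_3, y_4) : ρ > 0, ((ρ,0), y_3,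
y_4) ∈ σ} ⊂ ℝ⁵ (tan-half-angle chart, Jacobian 2ρ/(1+u²)); used by StarFourDisc, TriangleDisc.
[difficulty: M] [KontsevichZagier2001, SantaloKac2004]
#9 TriangleDisc (support) — B_3 of hard discs as a chain (first appearance of the even-dimension
√3): r = [C_{K3}, 1] ⊂ ℝ⁴ (three mutual distances < 1), value π² − (3√3/4)π (B_3/B_2² = 4/3 − √3/π;
confirmed to 10⁻⁵⁰ as 4π²∫J₁³t⁻²): 4·[r] − 4·[π]² + 3·[√3][π] ∈ KZ.relations (typed PRODUCT-FREE,
route-repair 2026-08-15: [π]² any integrand-1 p over disc × disc ⊂ ℝ⁴, closed unit discs; [√3][π]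
any integrand-1 s over (0,√3) × disc ⊂ ℝ³) — the one-arccos calibration of StarFourDisc's method.
[difficulty: M] [Urrutia2022, ClisbyMccoy2004, KontsevichZagier2001]
#9 RingFourSphere (support) — The ring diagram of B_4 for hard spheres: r = [C_{C4}, 1] ⊂ ℝ⁹ (edges
12, 23, 34, 41 short), value ∫_{|ρ|<2} L(ρ)² d³ρ = 2176π³/2835 (L the lens volume; rational×π³ in
odd D, Lyberg2005 §2; Monte-Carlo 23.50 ± 0.26): 2835·[r] − 2176·[π]³ ∈ KZ.relations (typed
PRODUCT-FREE, route-repair 2026-08-15: [π]³ any integrand-1 p over disc³ ⊂ ℝ⁶, closed unit discs);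
polynomial primitives only. [difficulty: M] [Lyberg2005, NijboerVanhove1952]
#9 DiamondFourSphere (support) — The diagonal (diamond) diagram of B_4 for hard spheres: r = [C_◇,
1] ⊂ ℝ⁹ (ring plus chord 13), value ∫_{|ρ|<1} L(ρ)² d³ρ = 6347π³/11340 (Monte-Carlo 17.27 ± 0.22):
11340·[r] − 6347·[π]³ ∈ KZ.relations (typed PRODUCT-FREE, route-repair 2026-08-15: [π]³ any
integrand-1 p over disc³ ⊂ ℝ⁶, closed unit discs); with RingFourSphere and StarFourSphere it
recomposes Boltzmann's B_4 (−8B_4 = 3V(C_4) − 6V(◇) + V(K_4)). [difficulty: M] [Lyberg2005,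
NijboerVanhove1952]
#9 PentagonNodes (support) — The algebraic kernel of the k = 5 prediction (card H3, corrected: the
planar stratum is NOT rational). For t ∈ ℂ⁵ ∖ 0 with e₁(t) = 0 and e₄(t) = 0 (closed planar
equilateral pentagons in a null coordinate: t_i = edge vectors, Σ t_i = 0, Σ 1/t_i = 0), the
gradient of e₄ is parallel to (1,…,1) — i.e. the point of the quartic surface {e₁ = e₄ = 0} ⊂ ℙ⁴ is
singular — iff t is a permutation of (a, −a, 0, 0, 0): exactly ten nodes (local form e₂(t₁,t₂,t₃),
nondegenerate), so the surface is an irreducible nodal quartic, a K3 surface. (The k = 4 analogue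
{e₁ = e₃ = 0} = {(t₁+t₂)(t₁+t₃)(t₂+t₃) = 0} is three lines: Tate, matching Clisby–McCoy's k = 4
value ring.) Proof: ∂_i e₄ = e₃ − t_i e₂ − t_i³ on e₁ = 0, so the t_i are roots of one depressed
cubic; multiplicity cases. [difficulty: provable-now] [HausmannKnutson1998, arXiv:math/9803150,
BorweinEtAl2012]
#9 NotUrrutiaDiscs (crux since 2026-08-16: gate AUTO-CRUX of a conjecture-grade support item, rank 9
kept) — NEGATION OF URRUTIA'S CONJECTURE 1 AT d = 2 FOR THE TOTAL B_5 (Urrutia2022 p. 12): with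
−30·B_5 = the signed sum of the ten biconnected 5-vertex Mayer diagrams (multiplicities 12, 60, 10,
60, 30, 10, 15, 30, 10, 1, signs (−1)^|E|; typed as ten integrand-1 representations of dimension 8
by grounder g14-24 / refuter g41-47, rc 0, bookkeeping enumerated) and B_2 = π/2, there are NO
rationals a₀..a₃ with B_5/B_2⁴ = a₀ + a₁√3/π + a₂/π² + a₃√3/π³. A value statement outside the
implication chain; RingFiveDiscBeyondPattern is the attackable per-diagram form, this one speaks to
the printed conjecture. [deps: RingFiveDiscValue] [difficulty: XL] (why it might fail: The CM(−15)
constant G of the 5-ring may CANCEL across the ten diagrams — each diagram containing a 5-cycle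
meets the pentagon K3 stratum (cf. Lyberg2005 §4: √3/π parts of E7β, E8β cancel in a partial D = 3
sum); only 8 digits of B_5(disc) are known (Kratky1976), so the total has no PSLQ evidence yet.)
[Urrutia2022, Kratky1976, ReeHoover1964, ClisbyMccoy2005, Lyberg2005]
#9 VolumeFormOfKernel (support, glue) — Crux… → VolumeForm (route-choice repair 2026-08-16, option
(a) of the operator hold): UnitDistanceKernel → StarFourSphere → StarFourDisc →
IsotropyFactorisation3 → VolumeForm. PROVED in Sketch.lean (`volumeFormOfKernel_holds`, rc 0): `fun
hK h2 h4 h5 N r r' hr hr' hv => hK KZ.relations le_rfl h2 h4 h5 r r' hr hr' hv` — instantiate R :=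
KZ.relations; a prover copies it verbatim into Theorems/. The same term is the body of `closes`.
[deps: UnitDistanceKernel, StarFourSphere, StarFourDisc, IsotropyFactorisation3] [difficulty:
provable-now] [KontsevichZagier2001]

TWO-LAYER PLAN. Foreseen glued splits (k ≤ 3, depth 1), filed only when a crux closes or stalls with
a census: StarFourSphere ⇐
QuadrupleLensCells (semialgebraic cell decomposition of C_{K4} by the order type of the six
distances, each cell a band for
rule 3) → DihedralSectorTrade (every arccos/dihedral factor produced by a descent is carried as a
[sector] and traded against
[π] by the half-angle map; SphericalSchlafli.RationalAngleSquares is the model) → StarFourSphere;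
StarFourDisc ⇐ RhombusCells
→ LensSectorTrade → StarFourDisc; RingFiveDiscValue ⇐ DiscStepsAreFourDimensional (V(C_5) =
16π⁴∫J₁⁵t⁻⁴ and the ν = 1 → ν = 0
recursion) → PentagonResidues (ρ and r₅,₁ evaluations, BorweinEtAl2012/Borwein2016) →
RingFiveDiscValue; then the typed NON-TATE
CONJECTURE-1 INSTANCE RingFiveDiscCompiles: [C_{C5}, 1] ∼ [π]⁴ − a·[π]·[ω-rep]² − b·[π]·[η-rep]²
over an explicit CM(−15) curve
(ρ = alg·ω²/π³ by Chowla–Selberg, 1/(π⁴ρ) = alg·(π/ω)²/π³ and π/ω ∈ ℚ̄η + ℚ̄ω for CM), with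
PentagonPeriodRep (ρ as the
2-dimensional algebraic integral of 2/(πσ√(4−σ²)) over the torus chart) as its definition request.

KILL CRITERIA. Every typed accessibility item (StarFourSphere, StarFourDisc, Triangle*,
Ring/DiamondFourSphere, Isotropy*) has CERTIFIED
equal values (Boltzmann–Nijboer–van Hove–Lyberg; Rowlinson–Hemmer–Clisby–McCoy; this session's lens
integrals, Monte-Carlo
and 50-digit Bessel checks): a genuine non-derivability proof for any of them refutes the SUMMIT
(each is an instance of Conjecture 1: integrand 1 is KZ-rational data,
`kzKernelConjecture_iff_isRational`; the bookkeeping item SectorOfSummit that recorded this was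
dropped 2026-08-16 as not load-bearing) — close
`refuted:<Decl>`, report to the operator, hand the witness to route Neg. UnitDistanceKernel cannot
be refuted route-locally either: VolumeForm ⇒ it
and summit ⇒ it (Sketch.lean), so ¬UnitDistanceKernel is ¬(Conjecture 1) and goes to route Neg; the
glue VolumeFormOfKernel is proved (nothing to kill). A refutation 'as typed' (a coefficient or a
domain
slipped) forces a 1:1 --restate with the corrected constant, never a pivot. RingFiveDiscValue
refuted 'as typed' (a refuter's 100-digit recomputation
disagrees) forces a --restate with the corrected constants (the verification job j000545 is the
first such audit);
refuted in substance (no closed form of this shape) reopens the switch: RingFiveDiscBeyondPattern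
then stands alone on PSLQ
exclusion and the k = 5 text is rewritten. RingFiveDiscBeyondPattern refuted (rationals a₀..a₄
exhibited) would contradict
RingFiveDiscValue plus Chudnovsky — close the k = 5 branch `refuted:` and keep the B_4 ladder.
PentagonNodes refuted (more or fewer singular points) voids the motivic reason and forces the k = 5
text to be rewritten before any further k = 5 item. VolumeForm settled elsewhere (either way) moots
the target, not the ladder.

NOT DECOMPOSED YET. The per-cell move plans of the two star chains (layer-2 children above); the D =
3, k = 5 side (ring and K_5 − e
diagrams known exactly: KimHenderson1968, Lyberg2005 Table b5; the complete star E10 unknown —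
spatial unit pentagons form the
degree-5 del Pezzo surface and the equilateral spherical 4-bar splits into rational curves (w =
±cot(φ/2), checked by hand),
so the route predicts B_5(spheres) stays in the polylogarithmic (Artin–Tate) world: NOT filed until
the disc switch is
decided); the numerical side of the total-B_5(disc) statement NotUrrutiaDiscs (now a typed crux: the
other nine diagram values to ≥ 30 digits by
dimension-reduced integrals, Kratky's method, before any PSLQ claim); B_3 of hard spheres as a chain
— 6·[C_{K3}, 1] − 5·[p] ∈ KZ.relations for
r = [C_{K3}, 1] ⊂ ℝ⁶ (three mutual distances < 1, value 5π²/6: lens volume π(4+ρ)(2−ρ)²/12 is a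
polynomial times π) and any integrand-1 p over
disc × disc ⊂ ℝ⁴ (the former support item TriangleSphere, dropped 2026-08-16 to keep 15 items:
provable-now calibration of the D = 3 engine, to be
attached by a prover with --supports RingFourSphere / StarFourSphere); the general-k engine
(finProdFinEquiv bookkeeping) and the two-point engines (provers attach them with --supports);
LinkageStrata for D = 3 as a
rationality statement (needs 'rational variety' for real algebraic sets — definition request
deferred); any use of
Beilinson–Deligne–Goncharov period descriptions (prediction engine only, never a hypothesis).

CHEAPEST FALSIFIER. RUN THIS SESSION: (i) kit j000354/j000494 — V(C_3), V(C_4) of discs as Bessel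
moments match the closed forms to 10⁻⁵⁰; ∫tJ₀⁵ =
√5Γ(1/15)Γ(2/15)Γ(4/15)Γ(8/15)/(40π⁴) to 6·10⁻⁵²; V(C_5)(disc) to 90 digits; PSLQ at 87 digits: NO
relation with {π⁴, √3π³, π², √3π, 1}
below height 10¹², none with the 14-term Tate basis (Cl₂(π/3), ζ(3), log 2, log 3) below 10⁵, and on
the 16-term basis
{1, ρ, 1/(π⁴ρ)}·{π⁴, √3π³, π², √3π, 1} ONLY the sparse relation −1152V + 1152π⁴ − 1072ρπ⁴ − 11835/ρ
= 0 (stable 10⁵ → 10⁶) =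
RingFiveDiscValue (the 42-digit 'relations' of j000354 have residuals 10⁻³¹ at 95 digits:
artefacts); (ii) Monte-Carlo of all six
B_4 diagram volumes (num/b4_mc.py, num/k4disc_mc.py) within 1σ of the typed constants (V(K_4)(disc)
8.485 ± 0.030 vs 8.5065;
V(K_4)(sphere) 11.51 ± 0.18 vs 11.639). STILL CHEAP FOR A REFUTER: recompute V(C_5) to 150 digits
independently (real-space
2π∫ρA(ρ)T(ρ)dρ, or quadosc with another splitting; kit j000545 = num/ring5_identity_check.py is the
110-digit audit) and re-test
the identity; re-derive V(◇)(disc) = π³ − √3π² − 5π/6 symbolically; Monte-Carlo V(C_5) ≈ 36.36.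

NUMBERS. σ = 1, x_1 = 0, V_G = vol{|x_i − x_j| < 1, ij ∈ E(G)}, D_G = (−1)^|E| V_G, B_4 =
−(1/8)(3D(C_4) + 6D(◇) + D(K_4)). D = 2: V(K_3) =
π² − 3√3π/4 = 5.78856; V(C_4) = π³ − 16π/3 = 14.25112; V(◇) = π³ − √3π² − 5π/6 = 11.2934; V(K_4) =
π³ − (3√3/2)π² + π = 8.5065;
Ree–Hoover check V(C_4) − 2V(◇) + V(K_4) = (√3/2)π² − 8π/3 = 0.170 > 0; B_4/B_2³ = 2 − 9√3/(2π) +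
10/π² = 0.53223 (⊠ part 2 − 3√3/π +
2/π² = 0.5487, Ree–Hoover ring part −3√3/(2π) + 8/π² = −0.0164). D = 3: lens L(ρ) = π(4+ρ)(2−ρ)²/12;
V(K_3) = 5π²/6; V(C_4) =
2176π³/2835 = 23.799; V(◇) = 6347π³/11340 = 17.354; V(K_4) = −(356/945)π³ − (73/315)√2π² +
(153/70)arccos(1/3)π² = 11.639; B_4/B_2³
= 0.28695 (⊠ 0.3168, Ree–Hoover ring −0.0298). Discs as Bessel moments: V(C_k) = (2π)^(k−1) I_k, I_3
= 1/4 − 3√3/(16π), I_4 =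
1/8 − 2/(3π²), I_5 = 0.02333233718003034735761206726134010324371266185661711775924255549346862… ;
V(C_5) =
36.36450810248985310500301619079581854252410808962645453107075884104143706232…; p₄(1) = ρ =
0.3299338010600640590… (BSWZ Gamma
form confirmed to 6·10⁻⁵²); G = 574.91188972866997566815835532…; identity V(C_5) = π⁴ − (67√5/2880)G
− (1315√5/16)π⁴/G, i.e.
P(|S_4| < 1) = 0.37332… = 1 − (67/72)ρ − (1315/128)/(π⁴ρ) for disc-uniform steps (Kluyver's
unit-step value would be 1/5). B_5/B_2⁴ numerically: 0.33355604 (D = 2, Kratky1976), 0.110252 (D =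
3, ClisbyMccoy2005). Items at
open: 14 typed (1 target, 1 assembly, 5 cruxes, 7 support) + 2 informal statements filed right after
open; after the route-choice repair of
2026-08-16: 15 (1 target VolumeForm, 1 assembly, 7 cruxes = StarFourSphere, RingFiveDiscValue,
StarFourDisc, IsotropyFactorisation3,
RingFiveDiscBeyondPattern, UnitDistanceKernel, NotUrrutiaDiscs, 6 support = IsotropyFactorisation2,
TriangleDisc, RingFourSphere, DiamondFourSphere,
PentagonNodes, VolumeFormOfKernel).

DEFINITION REQUESTS. None blocking; the route file is typed over KZCalculus alone (route-repair
2026-08-15: products [π]^k, [√2][π]², [θ][π]², chart × reduced configuration are single integrand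
representations over product domains, so KZProduct's open theses PiCancellation / PiLocalKernel are
NOT in this route's cone and are not needed by any item). Deferred (see Not decomposed yet):
`IsRationalRealVariety` (Literature/AlgebraicGeometry) to type LinkageStrata
for D = 3; a `PentagonPeriodRep` (Summits/…/Theorems) once the Chowla–Selberg fit of V(C_5) is
known. Cite facts wanted (filed as
informal text, not hypotheses of any item): Clisby–McCoy's even-D theorem and Lyberg's odd-D theorem
for B_4 (value rings),
BSWZ Thm (p₄(1) Gamma evaluation).

Novelty: Searches (2026-08-15): `lit search "fourth virial coefficient hard spheres even dimensions analytic
Clisby McCoy"` (7 local: Lyberg2005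
= paper:arxiv-cond-mat_0410080 READ pp. 3–9 — two-centre formalism, 'elliptic integrals cancel in
even D', Conjecture 1 'every B_n
analytically computable', Table b5 partial D = 3 diagrams with √3/π; Urrutia2022 =
paper:arxiv-2109.11660 READ p. 12: Conjecture 1
B_5/B_2⁴ ∈ ℚ + ℚ√3/π + ℚ/π² + ℚ√3/π³ in even d; 11 remote: ClisbyMccoy2004/2005, Nairn–Kilpatrick
1972, Saija et al.); `lit search
--source crossref "hard disk virial coefficients Bessel functions ring integrals"` (11: equations of
state, none on Bessel moments or
periods); `lit search --source crossref "Kratky fifth virial coefficient hard disks"` (Kratky1976,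
ReeHoover1964, KimHenderson1968,
Wheatley 1998 — numerics/partial exact D = 3); `lit galaxy search "virial coefficient" --star all`
(49 rows: physical chemistry,
physiology, none mathematical); `lit galaxy search "short uniform random walks" --star all` (7:
Borwein2016 survey READ pp. 26–27,
79–80 = pdf:-5707705939127148220: eqs. (29)–(32), Kluyver, P_2(ν;1) = 1/3 − c√3/π, P_3(ν;1) = 1/4 −
c/π² — the same value shapes as
B_3 and the disc ring); `lit frontier KontsevichZagierPeriods --since 2020` (30 rows: MZV, odd zeta,
CM Kummer surfaces — none on
configuration volumes); `lit bridges KontsevichZagierPeriods --cross any` (30: none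
statistical-mechanical); all 56 route files of
the sub-problem grepped for virial|hard sphere|Mayer  [refs: 10.1023/b:joss.0000013959.30878.d2, 10.1007/s10955-005-3020-6, 10.4153/CJM-2011-079-2, 2109.11660, paper:arxiv-cond-mat_0410080, paper:arxiv-2109.11660, doi:10.1023/b, doi:10.1007/s10955-005-3020-6, doi:10.4153/CJM-2011-079-2, Lyberg2005, Urrutia2022, ClisbyMccoy2004, Kratky1976, ReeHoover1964, KimHenderson1968, Borwein2016, BorweinEtAl2012, MontrollMayer1941]

Barriers (technique_class: configuration-volume, quadric-arrangement, bessel-moment): - technique_class: configuration-volume, quadric-arrangement, bessel-moment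
- Literature.Barriers.KontsevichZagierPeriods.noSemialgebraicPrimitive_inv_sub_two: ENGAGED and
evaded by design — the lens area 2arccos(ρ/2) − (ρ/2)√(4−ρ²), the dihedral angle arccos(1/3) and
every full-turn factor 2π, 4π are transcendental primitives, so no chain integrates an angular or
lens variable OUT: IsotropyFactorisation2/3 carry the rotation as [ℝ, 2/(1+u²)] / [ℝ², 4/(1+|u|²)²],
arccos factors are kept unfolded as sector areas (one extra variable) and traded against [π] by the
half-angle change of variables; the only rule-3 primitives are polynomial (odd-D lens volumes) or
semialgebraic on explicit cells. The declared failure mode of StarFourSphere/StarFourDisc is exactly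
a place where this discipline cannot be kept.
- Literature.Barriers.KontsevichZagierPeriods.cressonViuSos_prop_3_2: respected — every chain
dissects first (order-type cells of the six distances, null sets ρ = 0 and the Householder pole) and
maps pieces; no global dissection-free semialgebraic map between C_{K4} and a product of discs and
sectors is claimed.
- Literature.Barriers.KontsevichZagierPeriods.kzConjecture_implies_oddZetaAlgIndep: bites only the
target VolumeForm (summit-equivalent, said openly) and, in spirit, RingFiveDiscBeyondPattern (a
non-membership statement no current transcendence method proves — filed as a switch decided by
evidence, difficulty open-problem); every accessibility item is unconditional with

Novelty grade: new-combination — ROUTE REVIEW #3 rreview-0815T12-8 (refuter, 08-16 04:10Z; reviews #1/#2 STAND). VERDICT: KEEP OPEN; no objection; no crux blocked. #1/#2's structural recommendation (relativise the summit-equivalent target) is EXECUTED (rev 2/3, 03:23–03:28Z): crux 14472 UnitDistanceKernel (kernel of KZ^{ud} on volu (refuter refuter-rreview-0815T12-8-0, 2026-08-16T04:00:23Z; prior: arXiv:cond-mat/0410080 (Lyberg2005), doi:10.1023/b:joss.0000013959.30878.d2 (ClisbyMcCoy2004), NijboerVanHove1952; Rowlinson1964/Hemmer1965 (B4 closed forms),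 arXiv:1508.04729 (Borwein–Straub–Vignat 2016, Ex. 3.28 + Thm 4.17), doi:10.4153/CJM-2011-079-2 (BSWZ2012, p4(1) and r_{5,0}), arXiv:1708.02857 (Zhou 2019, Thm 2.2), arXiv:2109.11660 (Urrutia2022, Conj. 1 p.12), Kratky1976 (B5 of hard discs, )

History (route lifecycle, newest last):
- 2026-08-15T16:16:06Z · rev 1: restated StarFourSphere (stmt-KontsevichZagierPeriods-8519), StarFourDisc (stmt-KontsevichZagierPeriods-8521), IsotropyFactorisation3 (stmt-KontsevichZagierPeriods-8522), IsotropyFactorisation2 (stmt-KontsevichZagierPeriods-8524), TriangleDisc (stmt-KontsevichZagierPeriods-8525), TriangleSphere (stmt-KontsevichZ (planner-rbadge-KontsevichZagierPeriods-HardSph-f528179d-g2-0)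
- 2026-08-15T16:16:06Z · rev 1: dropped stmt-KontsevichZagierPeriods-8532 — route-repair (cone guardrail + glue): 8 items restated PRODUCT-FREE (cylinder convention of SphericalSchlafli; content, constants, ranks, why/sources unchanged; (planner-rbadge-KontsevichZagierPeriods-HardSph-f528179d-g2-0)
- 2026-08-16T02:18:24Z · AUTO-CRUX: 1 conjecture-grade item(s) promoted to crux (NotUrrutiaDiscs) — refuter vetting / tiering apply (operator:999:1362873)
- 2026-08-16T03:23:26Z · rev 2: dropped SectorOfSummit, TriangleSphere — route-choice repair step 1/2 (operator hold target-unreachable: VolumeForm; option (a) glue Crux… → VolumeForm): make room under the 15-item cap for the kernel (planner-rchoice-KontsevichZagierPeriods-HardSp-cf946b0c-0)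
- 2026-08-24T06:18:19Z · DORMANT — reconciler: no traction for 6.6 d (last activity item-proof-filed at 2026-08-17T15:54:24Z); parked, not closed — `ledger route dormant route-KontsevichZagierPer (operator:999:3645821)
- 2026-08-31T08:39:03Z · REACTIVATED (open) — reconciler: reactivated — activity statement-checked at 2026-08-31T07:27:55Z after parking at 2026-08-24T06:18:19Z (operator:999:672172)

sub-problem: KontsevichZagierPeriods · status: open · opened planner-plancard-KontsevichZagierPeriods-Kont-845919b4-0 2026-08-15T12:56:48Z · rev 6 · ledger route-KontsevichZagierPeriods-HardSphereVirial
GENERATED by the gate from the ledger (D-0016/17). Provers cite these decls: `theorem foo : Summit.KontsevichZagierPeriods.KontsevichZagierPeriods.Theses.HardSphereVirial.<Decl> := …` in Summits/KontsevichZagierPeriods/KontsevichZagierPeriods/Theorems/<Name>.lean.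
-/

namespace Summit.KontsevichZagierPeriods.KontsevichZagierPeriods.Theses.HardSphereVirial

open scoped BigOperators Topology Manifold Classical MeasureTheory ProbabilityTheory Matrix InnerProductSpace ComplexConjugate ContinuousMap
open Filter Set Function TopologicalSpace MeasureTheory

attribute [summit_statement] _root_.KontsevichZagierPeriods

open Literature Periods

/-- item stmt-KontsevichZagierPeriods-3814 · target · rank 0 · open · by planner
why it might fail: Summit-equivalent, so every strength barrier applies: false iff an additive invariant of the four move sets refines volume on ℚ-semialgebraic sets.
sources: KontsevichZagier2001, ViuSos2021, CressonViusos2022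
[target] X — two integrand-1 integral representations of one dimension N with equal value are
KZ-equivalent (volume is the only KZ-invariant of finite-volume ℚ-semialgebraic sets);
summit-equivalent frame of the route, attacked here on the spherical sector. -/
@[route_item "route-KontsevichZagierPeriods-HardSphereVirial"]
def VolumeForm : Prop :=
  ∀ ⦃N : ℕ⦄ (r r' : Literature.NumberTheory.Transcendental.KZ.IntegralRep N), (∀ x ∈ r.domain, r.integrand x = 1) → (∀ x ∈ r'.domain, r'.integrand x = 1) → r.value = r'.value → Literature.NumberTheory.Transcendental.KZ.Equivalent r r'

-- earlier StarFourSphere (stmt-KontsevichZagierPeriods-8519, replaced 2026-08-15T16:16:06Z -> stmt-KontsevichZagierPeriods-10455): retired by None — ∀ (r : Literature.NumberTheory.Transcendental.KZ.IntegralRep 9), r.domain = {x | x 0 ^ 2 + x 1 ^ 2 + x 2 ^ 2 < 1 ∧ x 3 ^ 2 + x 4 ^ 2 + x 5 ^ 2 < 1 ∧ x 6 ^ 2 + x 7 ^ 2 + x 8 ^ 2 < 1 ∧ (x 0 - x 3) ^ 2 + (x 1 - x 4) ^ 2 + (x 2 - x 5) ^ 2 < 1 ∧ (x 0 - x 6)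 
/-- item stmt-KontsevichZagierPeriods-10455 · crux · rank 2 · open · by planner
why it might fail: The triple-intersection volume of three unit balls carries arctan terms in the distances (Rowlinson/Powell): a second transcendental fibre function before the last descent may force TWO unfoldings and an 11-dim detour; and only k·1890·(…) may be reachable (division is not a move).
sources: Lyberg2005, NijboerVanhove1952, ClisbyMccoy2004, KontsevichZagier2001
[crux] BOLTZMANN'S arccos(1/3) INSIDE THE RULES (card H2, TetraB4). For the complete-star Mayer
diagram of B_4 for hard spheres of diameter 1 in ℝ³ — r = [C_{K4}, 1] ⊂ ℝ⁹, C_{K4} = {(x_2,x_3,x_4)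
: all six |x_i − x_j| < 1, x_1 = 0}, value V = −(356/945)π³ − (73/315)√2·π² +
(153/70)·arccos(1/3)·π² = 11.639… (from Boltzmann/Nijboer–van Hove's B_4/B_2³ = 2707/4480 +
219√2/(2240π) − 4131·arccos(1/3)/(4480π) and the elementary ring/diamond values of RingFourSphere,
DiamondFourSphere; Monte-Carlo 11.51 ± 0.18) — and the representations [√2] = [(0,√2), 1], [θ] = [{0
≤ y₀, y₁² ≤ 8y₀², y₀²+y₁² ≤ 1}, 1] (double sector of half-angle arctan 2√2 = arccos(1/3), area θ),
[π] = [unit disc, 1]: 1890·[r] + 712·[π]³ + 438·[√2][π]² − 4131·[θ][π]² ∈ KZ.relations. PRODUCT-FREE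
TYPING (route-repair 2026-08-15, cylinder convention shared with SphericalSchlafli, so that the
route file imports KZCalculus only): [π]³ is any integrand-1 representation p over disc × disc ×
disc ⊂ ℝ⁶ (closed unit discs), [√2][π]² any integrand-1 s over (0,√2) × disc × disc ⊂ ℝ⁵, [θ][π]²
any integrand-1 a over sector × disc × disc ⊂ ℝ⁶ — i.e. KZ.of of the former KZ.IntegralRep.prod
terms (KZProduct.of_mul_of, which provers may s -/
@[route_item "route-KontsevichZagierPeriods-HardSphereVirial", crux]
def StarFourSphere : Prop :=
  ∀ (r : Literature.NumberTheory.Transcendental.KZ.IntegralRep 9), r.domain = {x | x 0 ^ 2 + x 1 ^ 2 + x 2 ^ 2 < 1 ∧ x 3 ^ 2 + x 4 ^ 2 + x 5 ^ 2 < 1 ∧ x 6 ^ 2 + x 7 ^ 2 + x 8 ^ 2 < 1 ∧ (x 0 - x 3) ^ 2 + (x 1 - x 4) ^ 2 + (x 2 - x 5) ^ 2 < 1 ∧ (x 0 - x 6) ^ 2 + (x 1 - x 7) ^ 2 + (x 2 - x 8) ^ 2 < 1 ∧ (x 3 - x 6) ^ 2 + (x 4 - x 7) ^ 2 + (x 5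 - x 8) ^ 2 < 1} → (∀ x ∈ r.domain, r.integrand x = 1) → ∀ (p : Literature.NumberTheory.Transcendental.KZ.IntegralRep 6), p.domain = {y | y 0 ^ 2 + y 1 ^ 2 ≤ 1 ∧ y 2 ^ 2 + y 3 ^ 2 ≤ 1 ∧ y 4 ^ 2 + y 5 ^ 2 ≤ 1} → (∀ y ∈ p.domain, p.integrand y = 1) → ∀ (s : Literature.NumberTheory.Transcendental.KZ.IntegralRep 5), s.domain = {y | (0 < y 0 ∧ y 0 ^ 2 < 2) ∧ y 1 ^ 2 + y 2 ^ 2 ≤ 1 ∧ y 3 ^ 2 + y 4 ^ 2 ≤ 1} → (∀ y ∈ s.domain, s.integrand y = 1) → ∀ (a : Literature.NumberTheory.Transcendental.KZ.IntegralRep 6), a.domain = {y | (0 ≤ y 0 ∧ y 1 ^ 2 ≤ 8 * y 0 ^ 2 ∧ y 0 ^ 2 + y 1 ^ 2 ≤ 1) ∧ y 2 ^ 2 + y 3 ^ 2 ≤ 1 ∧ y 4 ^ 2 + y 5 ^ 2 ≤ 1} → (∀ y ∈ a.domain, a.integrand y = 1) → (1890 : ℤ) • Literature.NumberTheory.Transcendental.KZ.of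 r + (712 : ℤ) • Literature.NumberTheory.Transcendental.KZ.of p + (438 : ℤ) • Literature.NumberTheory.Transcendental.KZ.of s - (4131 : ℤ) • Literature.NumberTheory.Transcendental.KZ.of a ∈ Literature.NumberTheory.Transcendental.KZ.relations

-- earlier StarFourDisc (stmt-KontsevichZagierPeriods-8521, replaced 2026-08-15T16:16:06Z -> stmt-KontsevichZagierPeriods-10456): retired by None — ∀ (r : Literature.NumberTheory.Transcendental.KZ.IntegralRep 6), r.domain = {x | x 0 ^ 2 + x 1 ^ 2 < 1 ∧ x 2 ^ 2 + x 3 ^ 2 < 1 ∧ x 4 ^ 2 + x 5 ^ 2 < 1 ∧ (x 0 - x 2) ^ 2 + (x 1 - x 3) ^ 2 < 1 ∧ (x 0 - x 4) ^ 2 + (x 1 - x 5) ^ 2 < 1 ∧ (x 2 - x 4) ^ 2 + (x 3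
/-- item stmt-KontsevichZagierPeriods-10456 · crux · rank 4 · open · by planner
why it might fail: Three simultaneous arccos fibres (three lenses meeting) must be unfolded at once: the chain may need dimension 9 and a semialgebraic cell decomposition of the unit-rhombus discriminant; a bookkeeping failure only shows as 'no chain found', never as a wrong value.
sources: ClisbyMccoy2004, Urrutia2022, ReeHoover1964, KontsevichZagier2001
[crux] THE EVEN-DIMENSION ANOMALY COMPILED (card H2, DiscB4). For the complete star of B_4 for hard
discs — r = [C_{K4}, 1] ⊂ ℝ⁶, value V = π³ − (3√3/2)π² + π = 8.5065… (from Rowlinson/Hemmer's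
B_4/B_2³ = 2 − 9√3/(2π) + 10/π², ClisbyMccoy2004, and the lens-area values V(C_4) = π³ − 16π/3, V(◇)
= π³ − √3π² − 5π/6 derived this session; Monte-Carlo 8.485 ± 0.030) — and [√3] = [(0,√3), 1], [π] =
[unit disc, 1]: 2·[r] − 2·[π]³ + 3·[√3][π]² − 2·[π] ∈ KZ.relations. PRODUCT-FREE TYPING
(route-repair 2026-08-15, cylinder convention shared with SphericalSchlafli, so that the route file
imports KZCalculus only): [π]³ is any integrand-1 representation p over disc³ ⊂ ℝ⁶ (closed unit
discs), [√3][π]² any integrand-1 s over (0,√3) × disc × disc ⊂ ℝ⁵, [π] any integrand-1 d over the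
closed unit disc ⊂ ℝ² (= KZ.of of the former KZ.IntegralRep.prod terms by KZProduct.of_mul_of).
Chain: IsotropyFactorisation2 peels [2π]; the fibre AREA of a lens, 2·arccos(ρ/2) − (ρ/2)√(4−ρ²), is
transcendental in the distance, so the point x_4 is NOT integrated out first: instead slice by the
distance variables, keep every arccos unfolded as a sector area (one extra variable each) and
discharge them against the [π] fa -/
@[route_item "route-KontsevichZagierPeriods-HardSphereVirial", crux]
def StarFourDisc : Prop :=
  ∀ (r : Literature.NumberTheory.Transcendental.KZ.IntegralRep 6), r.domain = {x | x 0 ^ 2 + x 1 ^ 2 < 1 ∧ x 2 ^ 2 + x 3 ^ 2 < 1 ∧ x 4 ^ 2 + x 5 ^ 2 < 1 ∧ (x 0 - x 2) ^ 2 + (x 1 - x 3) ^ 2 < 1 ∧ (x 0 - x 4) ^ 2 + (x 1 - x 5) ^ 2 < 1 ∧ (x 2 - x 4) ^ 2 + (x 3 - x 5) ^ 2 < 1} → (∀ x ∈ r.domain, r.integrand x = 1) → ∀ (p : Literature.NumberTheory.Transcendental.KZ.IntegralRep 6), p.domain = {y | y 0 ^ 2 + y 1 ^ 2 ≤ 1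 ∧ y 2 ^ 2 + y 3 ^ 2 ≤ 1 ∧ y 4 ^ 2 + y 5 ^ 2 ≤ 1} → (∀ y ∈ p.domain, p.integrand y = 1) → ∀ (s : Literature.NumberTheory.Transcendental.KZ.IntegralRep 5), s.domain = {y | (0 < y 0 ∧ y 0 ^ 2 < 3) ∧ y 1 ^ 2 + y 2 ^ 2 ≤ 1 ∧ y 3 ^ 2 + y 4 ^ 2 ≤ 1} → (∀ y ∈ s.domain, s.integrand y = 1) → ∀ (d : Literature.NumberTheory.Transcendental.KZ.IntegralRep 2), d.domain = {y | y 0 ^ 2 + y 1 ^ 2 ≤ 1} → (∀ y ∈ d.domain, d.integrand y = 1) → (2 : ℤ) • Literature.NumberTheory.Transcendental.KZ.of r - (2 : ℤ) • Literature.NumberTheory.Transcendental.KZ.of p + (3 : ℤ) • Literature.NumberTheory.Transcendental.KZ.of s - (2 : ℤ) • Literature.NumberTheory.Transcendental.KZ.of d ∈ Literature.NumberTheory.Transcendental.KZ.relations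

/-- item stmt-KontsevichZagierPeriods-17845 · crux · rank 4 · open · by planner
why it might fail: The cross term m(u)·c(u,u′) couples the abscissae non-separably: its unfolded solid over Ω may admit no cell decomposition with algebraic Newton–Leibniz primitives only (barrier noSemialgebraicPrimitive_inv_sub_two), forcing an extra unfolding dimension or no chain found; the value is proved.
sources: KontsevichZagier2001, ClisbyMccoy2004, HuberMullerStach2017
[crux] THE FAR-PAIR DEFECT COMPILES — the two-loop core of the disc star (crux-strategist split of
StarFourDisc, piece 3/3, shadowing move by move the PROVED value computation
Literature.MathematicalPhysics.StatisticalMechanics.HardDiscB4Volume, steps 4–5). For any honest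
quartic-moment cylinder qF = [B̄ × Far, |p|⁴] ⊂ ℝ⁶ — B̄ the closed unit disc in p = (x0,x1), Far =
{(y,z) ∈ L × L : |y − z| ≥ 1} in (x2..x5), L = {|y| < 1, |y − (1,0)| < 1} the unit-distance lens;
value (π/3)·Ψ, Ψ = vol Far = 1/4 − π²/18 + √3π/12 (HardDiscB4Volume `integral_sq_posPart`,
`volume_far_value`) — and the route's cylinders p = [disc³,1] (π³), s = [(0,√3) × disc²,1] (√3π²), d
= [disc,1] (π): 108·[qF] + 2·[p] − 3·[s] − 9·[d] ∈ KZ.relations (108·(π/3)Ψ = −2π³ + 3√3π² + 9π;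
Monte-Carlo vol Far = 0.15499 ± 0.0005 vs Ψ = 0.155138). Intended chain: peel [B̄,|p|⁴] as the
product class (KZProduct.of_mul_of; 3[B̄,|p|⁴] − [disc] ∈ relations by the landed
ballKernel/tateLifting_radialBand); reindex (y,z) = ((u,v),(u′,v′)) ↦ ((u,u′),(v,v′)) (a relation,
KZ.IntegralRep.of_sub_of_reindex_mem_relations); the (u,u′)-section of Far is two corner triangles
{|v| < m(u), |v′| < m(u′), |v − v′| ≥ c}, m(u)² = 1 − max(u²,(1−u) -/
@[route_item "route-KontsevichZagierPeriods-HardSphereVirial"]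
def FarPairMoment : Prop :=
  ∀ (qF : Literature.NumberTheory.Transcendental.KZ.IntegralRep 6), qF.domain = {x | x 0 ^ 2 + x 1 ^ 2 ≤ 1 ∧ (x 2 ^ 2 + x 3 ^ 2 < 1 ∧ (x 2 - 1) ^ 2 + x 3 ^ 2 < 1) ∧ (x 4 ^ 2 + x 5 ^ 2 < 1 ∧ (x 4 - 1) ^ 2 + x 5 ^ 2 < 1) ∧ 1 ≤ (x 2 - x 4) ^ 2 + (x 3 - x 5) ^ 2} → (∀ x ∈ qF.domain, qF.integrand x = (x 0 ^ 2 + x 1 ^ 2) ^ 2) → ∀ (p : Literature.NumberTheory.Transcendental.KZ.IntegralRep 6), p.domain = {y | y 0 ^ 2 + y 1 ^ 2 ≤ 1 ∧ y 2 ^ 2 + y 3 ^ 2 ≤ 1 ∧ y 4 ^ 2 + y 5 ^ 2 ≤ 1} → (∀ y ∈ p.domain, p.integrand y = 1) → ∀ (s : Literature.NumberTheory.Transcendental.KZ.IntegralRep 5), s.domain = {y | (0 < y 0 ∧ y 0 ^ 2 < 3) ∧ y 1 ^ 2 + y 2 ^ 2 ≤ 1 ∧ y 3 ^ 2 + y 4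 ^ 2 ≤ 1} → (∀ y ∈ s.domain, s.integrand y = 1) → ∀ (d : Literature.NumberTheory.Transcendental.KZ.IntegralRep 2), d.domain = {y | y 0 ^ 2 + y 1 ^ 2 ≤ 1} → (∀ y ∈ d.domain, d.integrand y = 1) → (108 : ℤ) • Literature.NumberTheory.Transcendental.KZ.of qF + (2 : ℤ) • Literature.NumberTheory.Transcendental.KZ.of p - (3 : ℤ) • Literature.NumberTheory.Transcendental.KZ.of s - (9 : ℤ) • Literature.NumberTheory.Transcendental.KZ.of d ∈ Literature.NumberTheory.Transcendental.KZ.relations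

-- earlier IsotropyFactorisation3 (stmt-KontsevichZagierPeriods-8522, replaced 2026-08-15T16:16:06Z -> stmt-KontsevichZagierPeriods-10457): retired by None — ∀ (σ : Set (Fin 9 → ℝ)), Literature.ModelTheory.ExponentialFields.IsSemialgebraic ℚ σ → (∀ R : Matrix (Fin 3) (Fin 3) ℝ, R.transpose * R = 1 → ∀ x : Fin 9 → ℝ, x ∈ σ ↔ (![(R.mulVec ![x 0, x 1, x 2]) 0, (R.mulVec ![x 0, x 1, x 2]) 1, (R.mulVec ![
/-- item stmt-KontsevichZagierPeriods-10457 · crux · rank 5 · closed · proved by Summit.KontsevichZagierPeriods.HardSphereVirial.isotropyFactorisation3_proof @ d4d9102857b2 (prover) · by planner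
why it might fail: Only 'as typed': rule 2 needs HasFDerivWithinAt and injectivity on the whole source, so the Householder pole ω = e₃ and ρ = 0 must be excised by rule 1a first; if IsSemialgebraicMapOn of the rational chart resists Tarski–Seidenberg bookkeeping the engine stalls on library gaps.
sources: KontsevichZagier2001, HuberMullerStach2017, Lyberg2005
[crux] THE ENGINE (card H5, symmetry half). For every ℚ-semialgebraic σ ⊂ (ℝ³)³ invariant under the
diagonal action of O(3) on the three points, [σ, 1] − [ℝ² × τ, (4/(1+a²+b²)²)·ρ²] ∈ KZ.relations —
typed PRODUCT-FREE (route-repair 2026-08-15) as ONE 9-dimensional representation q in the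
coordinates (a, b, ρ, y_3, y_4), i.e. KZ.of (c.prod t) of the chart c = [ℝ², 4/(1+a²+b²)²] and the
reduced configuration t = [τ, ρ²] (KZProduct.of_mul_of recovers the factorised reading) — where τ =
{(ρ, y_3, y_4) : ρ > 0, ((0,0,ρ), y_3, y_4) ∈ σ} ⊂ ℝ⁷ is the reduced configuration set and [ℝ²,
4/(1+a²+b²)²] (value 4π) is the stereographic chart of S². One rational change of variables x_2 =
ρ·ω(a,b), x_i = H_ω y_i (H_ω the Householder reflection exchanging e₃ and ω: rational in (a,b),
|det| = 1), Jacobian ρ²·4/(1+a²+b²)², injective off a null set, then rule 1a for the null sets; in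
the product-free typing no coordinate permutation / KZ.IntegralRep.prod bookkeeping is needed. The
configuration-space counterpart of KinematicFormulas' torus shear; every hard-sphere chain starts
with it. [difficulty: M] -/
@[route_item "route-KontsevichZagierPeriods-HardSphereVirial", crux]
def IsotropyFactorisation3 : Prop :=
  ∀ (σ : Set (Fin 9 → ℝ)), Literature.ModelTheory.ExponentialFields.IsSemialgebraic ℚ σ → (∀ R : Matrix (Fin 3) (Fin 3) ℝ, R.transpose * R = 1 → ∀ x : Fin 9 → ℝ, x ∈ σ ↔ (![(R.mulVec ![x 0, x 1, x 2]) 0, (R.mulVec ![x 0, x 1, x 2]) 1, (R.mulVec ![x 0, x 1, x 2]) 2, (R.mulVec ![x 3, x 4, x 5]) 0, (R.mulVec ![x 3, x 4, x 5]) 1, (R.mulVec ![x 3, x 4, x 5]) 2, (R.mulVec ![x 6, x 7, x 8]) 0, (R.mulVec ![x 6, x 7, x 8]) 1, (R.mulVec ![x 6, x 7, x 8]) 2] : Fin 9 → ℝ) ∈ σ) → ∀ (r : Literature.NumberTheory.Transcendental.KZ.IntegralRep 9), r.domain = σ → (∀ x ∈ r.domain, r.integrand x = 1) → ∀ (q :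 Literature.NumberTheory.Transcendental.KZ.IntegralRep 9), q.domain = {w | 0 < w 2 ∧ (![0, 0, w 2, w 3, w 4, w 5, w 6, w 7, w 8] : Fin 9 → ℝ) ∈ σ} → (∀ w ∈ q.domain, q.integrand w = 4 / (1 + w 0 ^ 2 + w 1 ^ 2) ^ 2 * w 2 ^ 2) → Literature.NumberTheory.Transcendental.KZ.of r - Literature.NumberTheory.Transcendental.KZ.of q ∈ Literature.NumberTheory.Transcendental.KZ.relations

-- `IsotropyFactorisation3` holds: proved by `Summit.KontsevichZagierPeriods.HardSphereVirial.isotropyFactorisation3_proof` @ d4d9102857b2 (its module imports this route file, so no `_holds` link can be stated here).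

/-- item stmt-KontsevichZagierPeriods-17844 · crux · rank 5 · open · by planner
why it might fail: genusZeroLowDimKernel gives membership only for combinations inside its generating set, so [disc], [(0,√3)] must first enter the conic/point sector (tateLifting_quarterPi) and ⟦L⟧² needs honest products (Tarski–Seidenberg bookkeeping); false only by a slipped coefficient (audited).
sources: KontsevichZagier2001, ClisbyMccoy2004, HuberMullerStach2017
[crux] THE LENS-SQUARE QUARTIC MOMENT COMPILES (crux-strategist split of StarFourDisc, piece 2/3).
For any honest cylinder qL = [B̄ × L × L, |p|⁴] ⊂ ℝ⁶ — B̄ the closed unit disc in p = (x0,x1), L =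
{|y| < 1, |y − (1,0)| < 1} the unit-distance lens (area 2π/3 − √3/2, HardDiscB4Volume
`volume_unitLens`) in (x2,x3) and in (x4,x5); value (π/3)(2π/3 − √3/2)² = 4π³/27 − 2√3π²/9 + π/4 —
and the route's cylinders p = [disc³,1], s = [(0,√3) × disc²,1], d = [disc,1]: 108·[qL] − 16·[p] +
24·[s] − 27·[d] ∈ KZ.relations. Intended chain, all but one step inside the landed toolkit
(Theorems/InverseLandauTateLifting*): Fubini product class ⟦qL⟧ = ⟦B̄,|p|⁴⟧·⟦L⟧·⟦L⟧
(KZProduct.of_mul_of + reindexing relations); radial moment 3·[B̄,|p|⁴] − [disc] ∈ relations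
(ballKernel / tateLifting_radialBand: ∫|p|⁴ = π/3); the NEW step is the LENS CHAIN 6·[L] − 4·[disc]
+ 3·[(0,√3)] ∈ relations — L is the union (rule 1a at x = 1/2) of the two conic bands y² < 1 −
(1−x)² over (0,1/2) and y² < 1 − x² over (1/2,1): one Newton–Leibniz move each
(tateLifting_bandArea) onto the conic one-forms 2√(1−x²), then the genus-zero sector
(GenusZero.conicBand_reduce, genusZeroLowDimKernel, tateLifting_quarterPi: Baker inside the -/
@[route_item "route-KontsevichZagierPeriods-HardSphereVirial"]
def LensSquareMoment : Prop :=
  ∀ (qL : Literature.NumberTheory.Transcendental.KZ.IntegralRep 6), qL.domain = {x | x 0 ^ 2 + x 1 ^ 2 ≤ 1 ∧ (x 2 ^ 2 + x 3 ^ 2 < 1 ∧ (x 2 - 1) ^ 2 + x 3 ^ 2 < 1) ∧ (x 4 ^ 2 + x 5 ^ 2 < 1 ∧ (x 4 - 1) ^ 2 + x 5 ^ 2 < 1)} → (∀ x ∈ qL.domain, qL.integrand x = (x 0 ^ 2 + x 1 ^ 2) ^ 2) → ∀ (p : Literature.NumberTheory.Transcendental.KZ.IntegralRep 6), p.domain =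 {y | y 0 ^ 2 + y 1 ^ 2 ≤ 1 ∧ y 2 ^ 2 + y 3 ^ 2 ≤ 1 ∧ y 4 ^ 2 + y 5 ^ 2 ≤ 1} → (∀ y ∈ p.domain, p.integrand y = 1) → ∀ (s : Literature.NumberTheory.Transcendental.KZ.IntegralRep 5), s.domain = {y | (0 < y 0 ∧ y 0 ^ 2 < 3) ∧ y 1 ^ 2 + y 2 ^ 2 ≤ 1 ∧ y 3 ^ 2 + y 4 ^ 2 ≤ 1} → (∀ y ∈ s.domain, s.integrand y = 1) → ∀ (d : Literature.NumberTheory.Transcendental.KZ.IntegralRep 2), d.domain = {y | y 0 ^ 2 + y 1 ^ 2 ≤ 1} → (∀ y ∈ d.domain, d.integrand y = 1) → (108 : ℤ) • Literature.NumberTheory.Transcendental.KZ.of qL - (16 : ℤ) • Literature.NumberTheory.Transcendental.KZ.of p + (24 : ℤ) • Literature.NumberTheory.Transcendental.KZ.of s - (27 : ℤ) • Literature.NumberTheory.Transcendental.KZ.of d ∈ Literature.NumberTheory.Transcendental.KZ.relations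

/-- item stmt-KontsevichZagierPeriods-14472 · crux · rank 7 · open · by planner
why it might fail: GPC-strength, openly (VolumeForm ⇒ it; it + the three chains ⇒ VolumeForm, Sketch.lean): false iff an additive invariant of KZ.FormalRep killing the four move sets — hence the B₄/isotropy relators, which are theorems — separates two equal-volume ℚ-semialgebraic sets.
sources: KontsevichZagier2001, HuberMullerStach2017, CressonViusos2022, ViuSos2021
[crux] KERNEL OF THE ENLARGED CALCULUS KZ^{ud} ON VOLUMES — the residual of X modulo this route's
ranked chains, relativised à la AmoebaArea.AmoebaKernel (route-choice repair 2026-08-16, option (a)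
of the operator hold 'target-unreachable'; route review #2's structural recommendation). For every
subgroup R of KZ.FormalRep with KZ.relations ≤ R that contains the three relator families of the
ranked cruxes, each written verbatim with `∈ R` in place of `∈ KZ.relations` — Boltzmann's star
1890·[C_{K4}] + 712·[π]³ + 438·[√2][π]² − 4131·[θ][π]² (StarFourSphere, D = 3), the disc star
2·[C_{K4}] − 2·[π]³ + 3·[√3][π]² − 2·[π] (StarFourDisc, D = 2) and [σ, 1] − [chart × reduced
configuration] for every O(3)-invariant ℚ-semialgebraic σ ⊂ (ℝ³)³ (IsotropyFactorisation3) — R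
contains KZ.of r − KZ.of r' for every dimension N and every pair of integrand-1 representations r r'
: KZ.IntegralRep N with r.value = r'.value. 'Freshman calculus with Boltzmann's B₄ identities and
rotation-peeling as extra rules has volume as its only invariant.' HONEST STATUS (all checked in the
planner's Sketch.lean, rc 0): VolumeForm ⇒ it (`unitDistanceKernel_of_volumeForm`: relations ≤ R),
summit ⇒ it (`unitDistanceKer -/
@[route_item "route-KontsevichZagierPeriods-HardSphereVirial", crux]
def UnitDistanceKernel : Prop :=
  ∀ R : AddSubgroup Literature.NumberTheory.Transcendental.KZ.FormalRep, Literature.NumberTheory.Transcendental.KZ.relations ≤ R → (∀ (r : Literature.NumberTheory.Transcendental.KZ.IntegralRep 9), r.domain = {x | x 0 ^ 2 + x 1 ^ 2 + x 2 ^ 2 < 1 ∧ x 3 ^ 2 + x 4 ^ 2 + x 5 ^ 2 < 1 ∧ x 6 ^ 2 + x 7 ^ 2 + x 8 ^ 2 < 1 ∧ (x 0 - x 3) ^ 2 + (x 1 - x 4) ^ 2 + (x 2 - x 5) ^ 2 < 1 ∧ (x 0 - x 6) ^ 2 + (x 1 - x 7) ^ 2 + (x 2 - x 8) ^ 2 <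 1 ∧ (x 3 - x 6) ^ 2 + (x 4 - x 7) ^ 2 + (x 5 - x 8) ^ 2 < 1} → (∀ x ∈ r.domain, r.integrand x = 1) → ∀ (p : Literature.NumberTheory.Transcendental.KZ.IntegralRep 6), p.domain = {y | y 0 ^ 2 + y 1 ^ 2 ≤ 1 ∧ y 2 ^ 2 + y 3 ^ 2 ≤ 1 ∧ y 4 ^ 2 + y 5 ^ 2 ≤ 1} → (∀ y ∈ p.domain, p.integrand y = 1) → ∀ (s : Literature.NumberTheory.Transcendental.KZ.IntegralRep 5), s.domain = {y | (0 < y 0 ∧ y 0 ^ 2 < 2) ∧ y 1 ^ 2 + y 2 ^ 2 ≤ 1 ∧ y 3 ^ 2 + y 4 ^ 2 ≤ 1} → (∀ y ∈ s.domain, s.integrand y = 1) → ∀ (a : Literature.NumberTheory.Transcendental.KZ.IntegralRep 6), a.domain = {y | (0 ≤ y 0 ∧ y 1 ^ 2 ≤ 8 * y 0 ^ 2 ∧ y 0 ^ 2 + y 1 ^ 2 ≤ 1) ∧ y 2 ^ 2 + y 3 ^ 2 ≤ 1 ∧ y 4 ^ 2 + y 5 ^ 2 ≤ 1} → (∀ y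 ∈ a.domain, a.integrand y = 1) → (1890 : ℤ) • Literature.NumberTheory.Transcendental.KZ.of r + (712 : ℤ) • Literature.NumberTheory.Transcendental.KZ.of p + (438 : ℤ) • Literature.NumberTheory.Transcendental.KZ.of s - (4131 : ℤ) • Literature.NumberTheory.Transcendental.KZ.of a ∈ R) → (∀ (r : Literature.NumberTheory.Transcendental.KZ.IntegralRep 6), r.domain = {x | x 0 ^ 2 + x 1 ^ 2 < 1 ∧ x 2 ^ 2 + x 3 ^ 2 < 1 ∧ x 4 ^ 2 + x 5 ^ 2 < 1 ∧ (x 0 - x 2) ^ 2 + (x 1 - x 3) ^ 2 < 1 ∧ (x 0 - x 4) ^ 2 + (x 1 - x 5) ^ 2 < 1 ∧ (x 2 - x 4) ^ 2 + (x 3 - x 5) ^ 2 < 1} → (∀ x ∈ r.domain, r.integrand x = 1) → ∀ (p : Literature.NumberTheory.Transcendental.KZ.IntegralRep 6), p.domain = {y | y 0 ^ 2 + y 1 ^ 2 ≤ 1 ∧ y 2 ^ 2 + y 3 ^ 2 ≤ 1 ∧ y 4 ^ 2 + y 5 ^ 2 ≤ 1} → (∀ y ∈ p.domain, p.integrand y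 = 1) → ∀ (s : Literature.NumberTheory.Transcendental.KZ.IntegralRep 5), s.domain = {y | (0 < y 0 ∧ y 0 ^ 2 < 3) ∧ y 1 ^ 2 + y 2 ^ 2 ≤ 1 ∧ y 3 ^ 2 + y 4 ^ 2 ≤ 1} → (∀ y ∈ s.domain, s.integrand y = 1) → ∀ (d : Literature.NumberTheory.Transcendental.KZ.IntegralRep 2), d.domain = {y | y 0 ^ 2 + y 1 ^ 2 ≤ 1} → (∀ y ∈ d.domain, d.integrand y = 1) → (2 : ℤ) • Literature.NumberTheory.Transcendental.KZ.of r - (2 : ℤ) • Literature.NumberTheory.Transcendental.KZ.of p + (3 : ℤ) • Literature.NumberTheory.Transcendental.KZ.of s - (2 : ℤ) • Literature.NumberTheory.Transcendental.KZ.of d ∈ R) → (∀ (σ : Set (Fin 9 → ℝ)), Literature.ModelTheory.ExponentialFields.IsSemialgebraic ℚ σ → (∀ M : Matrix (Fin 3) (Fin 3) ℝ, M.transpose * M = 1 → ∀ x : Fin 9 → ℝ, x ∈ σ ↔ (![(M.mulVec ![x 0, x 1, x 2]) 0, (M.mulVec ![x 0, x 1, x 2]) 1, (M.mulVec ![x 0,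 x 1, x 2]) 2, (M.mulVec ![x 3, x 4, x 5]) 0, (M.mulVec ![x 3, x 4, x 5]) 1, (M.mulVec ![x 3, x 4, x 5]) 2, (M.mulVec ![x 6, x 7, x 8]) 0, (M.mulVec ![x 6, x 7, x 8]) 1, (M.mulVec ![x 6, x 7, x 8]) 2] : Fin 9 → ℝ) ∈ σ) → ∀ (r : Literature.NumberTheory.Transcendental.KZ.IntegralRep 9), r.domain = σ → (∀ x ∈ r.domain, r.integrand x = 1) → ∀ (q : Literature.NumberTheory.Transcendental.KZ.IntegralRep 9), q.domain = {w | 0 < w 2 ∧ (![0, 0, w 2, w 3, w 4, w 5, w 6, w 7, w 8] : Fin 9 → ℝ) ∈ σ} → (∀ w ∈ q.domain, q.integrand w = 4 / (1 + w 0 ^ 2 + w 1 ^ 2) ^ 2 * w 2 ^ 2) → Literature.NumberTheory.Transcendental.KZ.of r - Literature.NumberTheory.Transcendental.KZ.of q ∈ R) → ∀ ⦃N : ℕ⦄ (r r' : Literature.NumberTheory.Transcendental.KZ.IntegralRep N), (∀ x ∈ r.domain, r.integrand x = 1) → (∀ x ∈ r'.domain, r'.integrand x = 1) → r.value = r'.value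 → Literature.NumberTheory.Transcendental.KZ.of r - Literature.NumberTheory.Transcendental.KZ.of r' ∈ R

/-- item stmt-KontsevichZagierPeriods-8520 · aside · rank 3 · open · by planner
why it might fail: It is an 87-digit PSLQ identity, not a theorem: it fails only 'as typed' (a slip in G or the domain) — or if the ν = 1 → ν = 0 Bessel recursion yields rationals agreeing to 85 digits by accident (probability ~10⁻²³); no proof is assembled anywhere yet.
sources: BorweinEtAl2012, Borwein2016, BorweinStraubVignat2016, Urrutia2022, Kratky1976, MontrollMayer1941
[crux] THE FIVE-RING OF HARD DISCS IN CLOSED FORM (found this session; card H4 delivered for one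
diagram). For the 5-ring Mayer diagram of hard discs, r = [C_{C5}, 1] ⊂ ℝ⁸ (cycle 1-2-3-4-5-1, x_1 =
0): r.value = π⁴ − (67√5/2880)·G − (1315√5/16)·π⁴/G with G = Γ(1/15)Γ(2/15)Γ(4/15)Γ(8/15);
equivalently V(C_5) = π⁴(1 − (67/72)ρ) − (1315/128)/ρ with ρ = p₄(1) = √5G/(40π⁴) the
Borwein–Straub–Wan–Zudilin density (BorweinEtAl2012; Borwein2016 eq. (31)), i.e. P(|S_4| < 1) = 1 −
(67/72)ρ − (1315/128)/(π⁴ρ) for four disc-uniform planar steps. Evidence: V(C_5) = 16π⁴∫₀^∞J₁⁵t⁻⁴dt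
to 90 digits (kit j000494; method exact to 10⁻⁵⁰ on V(C_3), V(C_4)); 87-digit PSLQ on the 16-element
basis {1, ρ, 1/(π⁴ρ)}·{π⁴, √3π³, π², √3π, 1} returns ONLY the sparse relation −1152V + 1152π⁴ −
1072ρπ⁴ − 11835/ρ = 0 (stable 10⁵ → 10⁶); Tate bases admit none below 10¹². A proof should run:
disc-uniform steps = unit steps in ℝ⁴ (BorweinStraubVignat2016 dimensional recursion ν = 1 → ν = 0),
modularity of p₄ and Chowla–Selberg for ρ, the W₅ residue relation r₅,₁ = (13/225)ρ − 2/(5π⁴ρ)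
(Borwein2016 eq. (32)) for the dual constant. [deps: PentagonNodes] [difficulty: XL] -/
@[route_item "route-KontsevichZagierPeriods-HardSphereVirial"]
def RingFiveDiscValue : Prop :=
  ∀ (r : Literature.NumberTheory.Transcendental.KZ.IntegralRep 8), r.domain = {x | x 0 ^ 2 + x 1 ^ 2 < 1 ∧ (x 2 - x 0) ^ 2 + (x 3 - x 1) ^ 2 < 1 ∧ (x 4 - x 2) ^ 2 + (x 5 - x 3) ^ 2 < 1 ∧ (x 6 - x 4) ^ 2 + (x 7 - x 5) ^ 2 < 1 ∧ x 6 ^ 2 + x 7 ^ 2 < 1} → (∀ x ∈ r.domain, r.integrand x = 1) → r.value = Real.pi ^ 4 - (67 * Real.sqrt 5 / 2880) * (Real.Gamma (1 / 15) * Real.Gamma (2 / 15) * Real.Gamma (4 / 15) * Real.Gamma (8 / 15)) - (1315 * Real.sqrt 5 / 16) * Real.pi ^ 4 / (Real.Gamma (1 / 15) * Real.Gamma (2 / 15) * Real.Gamma (4 / 15) * Real.Gamma (8 / 15))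

/-- item stmt-KontsevichZagierPeriods-17842 · support · rank 6 · open · by planner
[crux] ARGMAX–SCALING REDUCTION OF THE DISC STAR INSIDE THE RULES (crux-strategist split of
StarFourDisc, piece 1/3: the move-by-move shadow of HardDiscB4Volume.volume_star_eq_six_mul +
volume_P0 + volume_starProd, V(K₄) = 6·vol P₀ = 6·(π/3)·vol Std = 2π·vol Std). For the complete-star
representation r = [C_{K4}, 1] ⊂ ℝ⁶ there are honest cylinder representations qL = [B̄ × L × L,
|p|⁴] and qF = [B̄ × Far, |p|⁴] ⊂ ℝ⁶ (B̄ = closed unit disc in p = (x0,x1) = r₂; L = {|y| < 1, |y −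
(1,0)| < 1} the unit-distance lens in (x2,x3) and (x4,x5); Far = pairs of L × L at distance ≥ 1)
with [r] − 6·[qL] + 6·[qF] ∈ KZ.relations. Chain: (1a) C_{K4} = ⊔ᵢ Pᵢ ∪ ties, Pᵢ = {bond i is the
strict maximum of the six squared bonds |r₂|², |r₃|², |r₄|², |r₂−r₃|², |r₂−r₄|², |r₃−r₄|²} (the ties
are null, HardDiscB4Volume.volume_tie_eq_zero, and a null-domain representation is itself a
relation); (2) the relabelling symmetries of HardDiscB4Volume.exists_bond_symmetry — permutations of
r₂,r₃,r₄ and the re-rooting (r₂,r₃,r₄) ↦ (r₂−r₃, r₂, r₂−r₄), ℚ-linear of |det| = 1 — give [Pᵢ] ≡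
[P₀]; (2) ONE polynomial change of variables Φ(p,y,z) = (p, p·y, p·z) (complex multiplication on
both factors, |det Φ′| = |p|⁴, inj -/
@[route_item "route-KontsevichZagierPeriods-HardSphereVirial"]
def StarDiscScaling : Prop :=
  ∀ (r : Literature.NumberTheory.Transcendental.KZ.IntegralRep 6), r.domain = {x | x 0 ^ 2 + x 1 ^ 2 < 1 ∧ x 2 ^ 2 + x 3 ^ 2 < 1 ∧ x 4 ^ 2 + x 5 ^ 2 < 1 ∧ (x 0 - x 2) ^ 2 + (x 1 - x 3) ^ 2 < 1 ∧ (x 0 - x 4) ^ 2 + (x 1 - x 5) ^ 2 < 1 ∧ (x 2 - x 4) ^ 2 + (x 3 - x 5) ^ 2 < 1} → (∀ x ∈ r.domain, r.integrand x = 1) → ∃ (qL qF : Literature.NumberTheory.Transcendental.KZ.IntegralRep 6), qL.domain = {x | x 0 ^ 2 + x 1 ^ 2 ≤ 1 ∧ (x 2 ^ 2 + x 3 ^ 2 < 1 ∧ (x 2 - 1) ^ 2 + x 3 ^ 2 < 1) ∧ (x 4 ^ 2 + x 5 ^ 2 < 1 ∧ (x 4 - 1) ^ 2 + x 5 ^ 2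 < 1)} ∧ (∀ x ∈ qL.domain, qL.integrand x = (x 0 ^ 2 + x 1 ^ 2) ^ 2) ∧ qF.domain = {x | x 0 ^ 2 + x 1 ^ 2 ≤ 1 ∧ (x 2 ^ 2 + x 3 ^ 2 < 1 ∧ (x 2 - 1) ^ 2 + x 3 ^ 2 < 1) ∧ (x 4 ^ 2 + x 5 ^ 2 < 1 ∧ (x 4 - 1) ^ 2 + x 5 ^ 2 < 1) ∧ 1 ≤ (x 2 - x 4) ^ 2 + (x 3 - x 5) ^ 2} ∧ (∀ x ∈ qF.domain, qF.integrand x = (x 0 ^ 2 + x 1 ^ 2) ^ 2) ∧ Literature.NumberTheory.Transcendental.KZ.of r - (6 : ℤ) • Literature.NumberTheory.Transcendental.KZ.of qL + (6 : ℤ) • Literature.NumberTheory.Transcendental.KZ.of qF ∈ Literature.NumberTheory.Transcendental.KZ.relations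

/-- item stmt-KontsevichZagierPeriods-8523 · aside · rank 6 · open · by planner
why it might fail: Only if RingFiveDiscValue is a numerical accident AND the volume class pairs to zero with the K3's transcendental H²: then PSLQ would find a₀..a₄ — excluded to height 10¹² at 87 digits, so a refutation needs astronomically large rationals.
sources: Urrutia2022, ClisbyMccoy2004, BorweinEtAl2012, Borwein2016, BorweinStraubVignat2016, Kratky1976
[crux] THE k = 5 SWITCH AGAINST URRUTIA'S PATTERN (card H3, sharpened). The 5-ring Mayer diagram of
hard discs, r = [C_{C5}, 1] ⊂ ℝ⁸, value 36.3645081024898531050030161907958185425… (90 digits, kit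
j000494), is NOT in ℚπ⁴ + ℚ√3π³ + ℚπ² + ℚ√3π + ℚ — the per-diagram extrapolation of Clisby–McCoy's
even-D theorem for k ≤ 4 and of Urrutia2022's printed Conjecture 1 (B_5/B_2⁴ = a₀ + a₁√3/π + a₂/π² +
a₃√3/π³). Motivic reason: the unit-pentagon stratum is a 10-nodal quartic K3 (PentagonNodes) whose
H²(−1) survives into H⁸(𝔸⁸, Q_{C5}) (the other strata are forests: Hodge–Tate, cannot kill a
(3,1)-class). Given RingFiveDiscValue it FOLLOWS from Chudnovsky's algebraic independence of π and
the period of a CM elliptic curve (G = algebraic·π·ω² for CM by ℚ(√−15), Chowla–Selberg): a genuine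
theorem target, and the recorded evidence is PSLQ exclusion to height 10¹² at 87 digits. [deps:
RingFiveDiscValue, PentagonNodes] [difficulty: L] -/
@[route_item "route-KontsevichZagierPeriods-HardSphereVirial"]
def RingFiveDiscBeyondPattern : Prop :=
  ∀ (r : Literature.NumberTheory.Transcendental.KZ.IntegralRep 8), r.domain = {x | x 0 ^ 2 + x 1 ^ 2 < 1 ∧ (x 2 - x 0) ^ 2 + (x 3 - x 1) ^ 2 < 1 ∧ (x 4 - x 2) ^ 2 + (x 5 - x 3) ^ 2 < 1 ∧ (x 6 - x 4) ^ 2 + (x 7 - x 5) ^ 2 < 1 ∧ x 6 ^ 2 + x 7 ^ 2 < 1} → (∀ x ∈ r.domain, r.integrand x = 1) → ∀ (q₀ q₁ q₂ q₃ q₄ : ℚ), r.value ≠ q₀ * Real.pi ^ 4 + q₁ * Real.sqrt 3 * Real.pi ^ 3 + q₂ * Real.pi ^ 2 + q₃ * Real.sqrt 3 * Real.pi + q₄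

-- earlier IsotropyFactorisation2 (stmt-KontsevichZagierPeriods-8524, replaced 2026-08-15T16:16:06Z -> stmt-KontsevichZagierPeriods-10458): retired by None — ∀ (σ : Set (Fin 6 → ℝ)), Literature.ModelTheory.ExponentialFields.IsSemialgebraic ℚ σ → (∀ R : Matrix (Fin 2) (Fin 2) ℝ, R.transpose * R = 1 → ∀ x : Fin 6 → ℝ, x ∈ σ ↔ (![(R.mulVec ![x 0, x 1]) 0, (R.mulVec ![x 0, x 1]) 1, (R.mulVec ![x 2, x 3])
/-- item stmt-KontsevichZagierPeriods-10458 · support · rank 9 · closed · proved by Summit.KontsevichZagierPeriods.HardSphereVirial.isotropyFactorisation2_proof @ 1497cee2c0e9 (prover) · by planner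
sources: KontsevichZagier2001, SantaloKac2004
[support] The plane engine: for O(2)-invariant ℚ-semialgebraic σ ⊂ (ℝ²)³, [σ, 1] − [ℝ × τ,
(2/(1+u²))·ρ] ∈ KZ.relations — typed PRODUCT-FREE (route-repair 2026-08-15) as ONE 6-dimensional
representation q in the coordinates (u, ρ, y_3, y_4), = KZ.of (c.prod t) of the chart c = [ℝ,
2/(1+u²)] (value 2π) and t = [τ, ρ] — with τ = {(ρ, y_3, y_4) : ρ > 0, ((ρ,0), y_3, y_4) ∈ σ} ⊂ ℝ⁵
(tan-half-angle chart, Jacobian 2ρ/(1+u²)); used by StarFourDisc, TriangleDisc. [difficulty: M] -/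
@[route_item "route-KontsevichZagierPeriods-HardSphereVirial"]
def IsotropyFactorisation2 : Prop :=
  ∀ (σ : Set (Fin 6 → ℝ)), Literature.ModelTheory.ExponentialFields.IsSemialgebraic ℚ σ → (∀ R : Matrix (Fin 2) (Fin 2) ℝ, R.transpose * R = 1 → ∀ x : Fin 6 → ℝ, x ∈ σ ↔ (![(R.mulVec ![x 0, x 1]) 0, (R.mulVec ![x 0, x 1]) 1, (R.mulVec ![x 2, x 3]) 0, (R.mulVec ![x 2, x 3]) 1, (R.mulVec ![x 4, x 5]) 0, (R.mulVec ![x 4, x 5]) 1] : Fin 6 → ℝ) ∈ σ) → ∀ (r : Literature.NumberTheory.Transcendental.KZ.IntegralRep 6), r.domain = σ → (∀ x ∈ r.domain, r.integrand x = 1) → ∀ (q : Literature.NumberTheory.Transcendental.KZ.IntegralRep 6), q.domain = {w | 0 < w 1 ∧ (![w 1, 0, w 2, w 3, w 4, w 5] : Fin 6 → ℝ) ∈ σ} → (∀ w ∈ q.domain, q.integrand w = 2 / (1 + w 0 ^ 2) * w 1) → Literature.NumberTheory.Transcendental.KZ.of r - Literature.NumberTheory.Transcendental.KZ.of q ∈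 Literature.NumberTheory.Transcendental.KZ.relations

-- `IsotropyFactorisation2` holds: proved by `Summit.KontsevichZagierPeriods.HardSphereVirial.isotropyFactorisation2_proof` @ 1497cee2c0e9 (its module imports this route file, so no `_holds` link can be stated here).

-- earlier TriangleDisc (stmt-KontsevichZagierPeriods-8525, replaced 2026-08-15T16:16:06Z -> stmt-KontsevichZagierPeriods-10459): retired by None — ∀ (r : Literature.NumberTheory.Transcendental.KZ.IntegralRep 4), r.domain = {x | x 0 ^ 2 + x 1 ^ 2 < 1 ∧ x 2 ^ 2 + x 3 ^ 2 < 1 ∧ (x 0 - x 2) ^ 2 + (x 1 - x 3) ^ 2 < 1} → (∀ x ∈ r.domain, r.integrand x = 1) → ∀ (s : Literature.NumberTheory.Transcendental.K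
/-- item stmt-KontsevichZagierPeriods-10459 · support · rank 9 · open · by planner
sources: Urrutia2022, ClisbyMccoy2004, KontsevichZagier2001
[support] B_3 of hard discs as a chain (first appearance of the even-dimension √3): r = [C_{K3}, 1]
⊂ ℝ⁴ (three mutual distances < 1), value π² − (3√3/4)π (B_3/B_2² = 4/3 − √3/π; confirmed to 10⁻⁵⁰ as
4π²∫J₁³t⁻²): 4·[r] − 4·[π]² + 3·[√3][π] ∈ KZ.relations (typed PRODUCT-FREE, route-repair 2026-08-15:
[π]² any integrand-1 p over disc × disc ⊂ ℝ⁴, closed unit discs; [√3][π] any integrand-1 s over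
(0,√3) × disc ⊂ ℝ³) — the one-arccos calibration of StarFourDisc's method. [difficulty: M] -/
@[route_item "route-KontsevichZagierPeriods-HardSphereVirial"]
def TriangleDisc : Prop :=
  ∀ (r : Literature.NumberTheory.Transcendental.KZ.IntegralRep 4), r.domain = {x | x 0 ^ 2 + x 1 ^ 2 < 1 ∧ x 2 ^ 2 + x 3 ^ 2 < 1 ∧ (x 0 - x 2) ^ 2 + (x 1 - x 3) ^ 2 < 1} → (∀ x ∈ r.domain, r.integrand x = 1) → ∀ (p : Literature.NumberTheory.Transcendental.KZ.IntegralRep 4), p.domain = {y | y 0 ^ 2 + y 1 ^ 2 ≤ 1 ∧ y 2 ^ 2 + y 3 ^ 2 ≤ 1} → (∀ y ∈ p.domain, p.integrand y = 1) → ∀ (s : Literature.NumberTheory.Transcendental.KZ.IntegralRep 3), s.domain = {y | (0 < y 0 ∧ y 0 ^ 2 < 3) ∧ y 1 ^ 2 + y 2 ^ 2 ≤ 1} → (∀ y ∈ s.domain, s.integrand y = 1) → (4 : ℤ) • Literature.NumberTheory.Transcendental.KZ.of r - (4 : ℤ) • Literature.NumberTheory.Transcendental.KZ.of p + (3 : ℤ)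 • Literature.NumberTheory.Transcendental.KZ.of s ∈ Literature.NumberTheory.Transcendental.KZ.relations

-- earlier RingFourSphere (stmt-KontsevichZagierPeriods-8527, replaced 2026-08-15T16:16:06Z -> stmt-KontsevichZagierPeriods-10461): retired by None — ∀ (r : Literature.NumberTheory.Transcendental.KZ.IntegralRep 9), r.domain = {x | x 0 ^ 2 + x 1 ^ 2 + x 2 ^ 2 < 1 ∧ (x 0 - x 3) ^ 2 + (x 1 - x 4) ^ 2 + (x 2 - x 5) ^ 2 < 1 ∧ (x 3 - x 6) ^ 2 + (x 4 - x 7) ^ 2 + (x 5 - x 8) ^ 2 < 1 ∧ x 6 ^ 2 + x 7 ^ 2 + x 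
/-- item stmt-KontsevichZagierPeriods-10461 · support · rank 9 · open · by planner
sources: Lyberg2005, NijboerVanhove1952
[support] The ring diagram of B_4 for hard spheres: r = [C_{C4}, 1] ⊂ ℝ⁹ (edges 12, 23, 34, 41
short), value ∫_{|ρ|<2} L(ρ)² d³ρ = 2176π³/2835 (L the lens volume; rational×π³ in odd D, Lyberg2005
§2; Monte-Carlo 23.50 ± 0.26): 2835·[r] − 2176·[π]³ ∈ KZ.relations (typed PRODUCT-FREE, route-repair
2026-08-15: [π]³ any integrand-1 p over disc³ ⊂ ℝ⁶, closed unit discs); polynomial primitives only.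
[difficulty: M] -/
@[route_item "route-KontsevichZagierPeriods-HardSphereVirial"]
def RingFourSphere : Prop :=
  ∀ (r : Literature.NumberTheory.Transcendental.KZ.IntegralRep 9), r.domain = {x | x 0 ^ 2 + x 1 ^ 2 + x 2 ^ 2 < 1 ∧ (x 0 - x 3) ^ 2 + (x 1 - x 4) ^ 2 + (x 2 - x 5) ^ 2 < 1 ∧ (x 3 - x 6) ^ 2 + (x 4 - x 7) ^ 2 + (x 5 - x 8) ^ 2 < 1 ∧ x 6 ^ 2 + x 7 ^ 2 + x 8 ^ 2 < 1} → (∀ x ∈ r.domain, r.integrand x = 1) → ∀ (p : Literature.NumberTheory.Transcendental.KZ.IntegralRep 6), p.domain = {y | y 0 ^ 2 + y 1 ^ 2 ≤ 1 ∧ y 2 ^ 2 + y 3 ^ 2 ≤ 1 ∧ y 4 ^ 2 + y 5 ^ 2 ≤ 1} → (∀ y ∈ p.domain, p.integrand y = 1) → (2835 : ℤ) • Literature.NumberTheory.Transcendental.KZ.of r - (2176 : ℤ) • Literature.NumberTheory.Transcendental.KZ.of p ∈ Literature.NumberTheory.Transcendental.KZ.relations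

-- earlier DiamondFourSphere (stmt-KontsevichZagierPeriods-8528, replaced 2026-08-15T16:16:06Z -> stmt-KontsevichZagierPeriods-10462): retired by None — ∀ (r : Literature.NumberTheory.Transcendental.KZ.IntegralRep 9), r.domain = {x | x 0 ^ 2 + x 1 ^ 2 + x 2 ^ 2 < 1 ∧ x 3 ^ 2 + x 4 ^ 2 + x 5 ^ 2 < 1 ∧ (x 0 - x 3) ^ 2 + (x 1 - x 4) ^ 2 + (x 2 - x 5) ^ 2 < 1 ∧ (x 3 - x 6) ^ 2 + (x 4 - x 7) ^ 2 + (x 5 - 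
/-- item stmt-KontsevichZagierPeriods-10462 · support · rank 9 · open · by planner
sources: Lyberg2005, NijboerVanhove1952
[support] The diagonal (diamond) diagram of B_4 for hard spheres: r = [C_◇, 1] ⊂ ℝ⁹ (ring plus chord
13), value ∫_{|ρ|<1} L(ρ)² d³ρ = 6347π³/11340 (Monte-Carlo 17.27 ± 0.22): 11340·[r] − 6347·[π]³ ∈
KZ.relations (typed PRODUCT-FREE, route-repair 2026-08-15: [π]³ any integrand-1 p over disc³ ⊂ ℝ⁶,
closed unit discs); with RingFourSphere and StarFourSphere it recomposes Boltzmann's B_4 (−8B_4 =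
3V(C_4) − 6V(◇) + V(K_4)). [difficulty: M] -/
@[route_item "route-KontsevichZagierPeriods-HardSphereVirial"]
def DiamondFourSphere : Prop :=
  ∀ (r : Literature.NumberTheory.Transcendental.KZ.IntegralRep 9), r.domain = {x | x 0 ^ 2 + x 1 ^ 2 + x 2 ^ 2 < 1 ∧ x 3 ^ 2 + x 4 ^ 2 + x 5 ^ 2 < 1 ∧ (x 0 - x 3) ^ 2 + (x 1 - x 4) ^ 2 + (x 2 - x 5) ^ 2 < 1 ∧ (x 3 - x 6) ^ 2 + (x 4 - x 7) ^ 2 + (x 5 - x 8) ^ 2 < 1 ∧ x 6 ^ 2 + x 7 ^ 2 + x 8 ^ 2 < 1} → (∀ x ∈ r.domain, r.integrand x = 1) → ∀ (p : Literature.NumberTheory.Transcendental.KZ.IntegralRep 6), p.domain = {y | y 0 ^ 2 + y 1 ^ 2 ≤ 1 ∧ y 2 ^ 2 + y 3 ^ 2 ≤ 1 ∧ y 4 ^ 2 + y 5 ^ 2 ≤ 1} → (∀ y ∈ p.domain, p.integrand y = 1) → (11340 : ℤ) • Literature.NumberTheory.Transcendental.KZ.of r - (6347 : ℤ) • Literature.NumberTheory.Transcendental.KZ.of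 p ∈ Literature.NumberTheory.Transcendental.KZ.relations

/-- item stmt-KontsevichZagierPeriods-14473 · support · rank 9 · closed · proved by Summit.KontsevichZagierPeriods.HardSphereVirial.volumeFormOfKernel_proof @ ce3a07b75489 (prover) · by planner
sources: KontsevichZagier2001, HuberMullerStach2017
[support] GLUE Crux… → VolumeForm (route-choice repair 2026-08-16, option (a) of the operator hold
'target-unreachable: no item concludes the target VolumeForm'): the kernel crux and the three ranked
relator cruxes give the target X. Proof = instantiate R := KZ.relations (le_rfl) in
UnitDistanceKernel; the three relator hypotheses are then literally StarFourSphere, StarFourDisc,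
IsotropyFactorisation3 (same bodies with ∈ KZ.relations), and KZ.Equivalent r r' unfolds to KZ.of r
− KZ.of r' ∈ KZ.relations. PROVED in the planner's Sketch.lean (`volumeFormOfKernel_holds`, rc 0,
one line): `fun hK h2 h4 h5 N r r' hr hr' hv => hK
Literature.NumberTheory.Transcendental.KZ.relations le_rfl h2 h4 h5 r r' hr hr' hv` — a prover
copies it verbatim into
Summits/KontsevichZagierPeriods/KontsevichZagierPeriods/Theorems/HardSphereVirialVolumeFormOfKernel.lean
as `theorem … : HardSphereVirial.VolumeFormOfKernel`. The same term is the body of the deciding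
theorem `closes (hK) (h2) (h4) (h5) (hA : Assembly) : KontsevichZagierPeriods := hA (…)`. [deps:
UnitDistanceKernel, StarFourSphere, StarFourDisc, IsotropyFactorisation3] [difficulty: provable-now] -/
@[route_item "route-KontsevichZagierPeriods-HardSphereVirial"]
def VolumeFormOfKernel : Prop :=
  UnitDistanceKernel → StarFourSphere → StarFourDisc → IsotropyFactorisation3 → VolumeForm

-- `VolumeFormOfKernel` holds: proved by `Summit.KontsevichZagierPeriods.HardSphereVirial.volumeFormOfKernel_proof` @ ce3a07b75489 (its module imports this route file, so no `_holds` link can be stated here).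

/-- item stmt-KontsevichZagierPeriods-8529 · support · rank 9 · closed · proved by Summit.KontsevichZagierPeriods.HardSphereVirial.pentagonNodes_proof @ 0f145e506653 (prover) · by planner
sources: HausmannKnutson1998, arXiv:math/9803150, BorweinEtAl2012
[support] The algebraic kernel of the k = 5 prediction (card H3, corrected: the planar stratum is
NOT rational). For t ∈ ℂ⁵ ∖ 0 with e₁(t) = 0 and e₄(t) = 0 (closed planar equilateral pentagons in a
null coordinate: t_i = edge vectors, Σ t_i = 0, Σ 1/t_i = 0), the gradient of e₄ is parallel to
(1,…,1) — i.e. the point of the quartic surface {e₁ = e₄ = 0} ⊂ ℙ⁴ is singular — iff t is a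
permutation of (a, −a, 0, 0, 0): exactly ten nodes (local form e₂(t₁,t₂,t₃), nondegenerate), so the
surface is an irreducible nodal quartic, a K3 surface. (The k = 4 analogue {e₁ = e₃ = 0} =
{(t₁+t₂)(t₁+t₃)(t₂+t₃) = 0} is three lines: Tate, matching Clisby–McCoy's k = 4 value ring.) Proof:
∂_i e₄ = e₃ − t_i e₂ − t_i³ on e₁ = 0, so the t_i are roots of one depressed cubic; multiplicity
cases. [difficulty: provable-now] -/
@[route_item "route-KontsevichZagierPeriods-HardSphereVirial"]
def PentagonNodes : Prop :=
  ∀ (t : Fin 5 → ℂ), t ≠ 0 → (∑ i, t i) = 0 → (∑ i, ∏ j ∈ Finset.univ.erase i, t j) = 0 → ((∀ i i' : Fin 5, (∑ S ∈ (Finset.univ.erase i).powersetCard 3, ∏ j ∈ S, t j) = (∑ S ∈ (Finset.univ.erase i').powersetCard 3, ∏ j ∈ S, t j)) ↔ ∃ (σ : Equiv.Perm (Fin 5)) (a : ℂ), a ≠ 0 ∧ t ∘ σ = ![a, -a, 0, 0, 0])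

-- `PentagonNodes` holds: proved by `Summit.KontsevichZagierPeriods.HardSphereVirial.pentagonNodes_proof` @ 0f145e506653 (its module imports this route file, so no `_holds` link can be stated here).

/-- item stmt-KontsevichZagierPeriods-8533 · aside (kind.auto-crux: conjecture-grade) · rank 9 · open · by planner
why it might fail: The CM(−15) constant G of the 5-ring may CANCEL across the ten diagrams (each one containing a 5-cycle meets the pentagon K3 stratum; cf. Lyberg2005 §4, √3/π parts of E7β/E8β cancel in a partial D = 3 sum); only 8 digits of B_5(disc) are known (Kratky1976): no PSLQ evidence for the total yet.
sources: Urrutia2022, arXiv:2109.11660, Kratky1976, ReeHoover1964, ClisbyMccoy2005, Lyberg2005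
[support] NEGATION OF URRUTIA'S CONJECTURE 1 AT d = 2 (Urrutia2022, arXiv:2109.11660 p. 12: 'for any
even dimension B_5/B_2⁴ = a₀ + a₁√3/π + a₂/π² + a₃√3/π³ with a_i rational'). Statement: with B_2 =
π/2 and −30·B_5 = −12V(C_5) + 60V(C_5+chord) + 10V(K_{2,3}) − 60V(fan) − 30V(C_5 + two crossing
chords) − 10V(K_5 − K_3) + 15V(W_4) + 30V(K_5 − P_3) − 10V(K_5 − e) + V(K_5) (the ten biconnected
graphs on five labelled vertices, multiplicities 12, 60, 10, 60, 30, 10, 15, 30, 10, 1 = 238, each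
V_G = vol{x ∈ ℝ⁸ : |x_i − x_j| < 1 for ij ∈ E(G)}, x_1 = 0; numerically B_5/B_2⁴ = 0.33355604,
Kratky1976), there are NO rationals a₀..a₃ with B_5/B_2⁴ = a₀ + a₁√3/π + a₂/π² + a₃√3/π³. To be
typed by a grounder (ten IsRational representations of dimension 8; the ∃-over-ℚ form negated). Why
the route wants it: the 5-ring alone already carries the CM(−15) constant G =
Γ(1/15)Γ(2/15)Γ(4/15)Γ(8/15) (RingFiveDiscValue) and every diagram containing a 5-cycle meets the
pentagon K3 stratum; a cancellation of G across the ten diagrams would itself be a theorem worth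
having. Why it might fail: exactly such a cancellation (cf. Lyberg2005 §4: the √3/π parts of E7β and
E8β cancel in the partial D = 3 sum), and -/
@[route_item "route-KontsevichZagierPeriods-HardSphereVirial"]
def NotUrrutiaDiscs : Prop :=
  ∀ (c5 : Literature.NumberTheory.Transcendental.KZ.IntegralRep 8) (ch : Literature.NumberTheory.Transcendental.KZ.IntegralRep 8) (k23 : Literature.NumberTheory.Transcendental.KZ.IntegralRep 8) (gem : Literature.NumberTheory.Transcendental.KZ.IntegralRep 8) (cr : Literature.NumberTheory.Transcendental.KZ.IntegralRep 8) (k5t : Literature.NumberTheory.Transcendental.KZ.IntegralRep 8) (w4 : Literature.NumberTheory.Transcendental.KZ.IntegralRep 8) (k5p : Literature.NumberTheory.Transcendental.KZ.IntegralRep 8) (k5e : Literature.NumberTheory.Transcendental.KZ.IntegralRep 8) (k5 : Literature.NumberTheory.Transcendental.KZ.IntegralRep 8), c5.domain = {x : Fin 8 → ℝ | x 0 ^ 2 + x 1 ^ 2 < 1 ∧ (x 2 - x 0) ^ 2 + (x 3 - x 1) ^ 2 < 1 ∧ (x 4 - x 2) ^ 2 + (x 5 - x 3) ^ 2 < 1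 ∧ (x 6 - x 4) ^ 2 + (x 7 - x 5) ^ 2 < 1 ∧ x 6 ^ 2 + x 7 ^ 2 < 1} → (∀ x ∈ c5.domain, c5.integrand x = 1) → ch.domain = {x : Fin 8 → ℝ | x 0 ^ 2 + x 1 ^ 2 < 1 ∧ (x 2 - x 0) ^ 2 + (x 3 - x 1) ^ 2 < 1 ∧ (x 4 - x 2) ^ 2 + (x 5 - x 3) ^ 2 < 1 ∧ (x 6 - x 4) ^ 2 + (x 7 - x 5) ^ 2 < 1 ∧ x 6 ^ 2 + x 7 ^ 2 < 1 ∧ x 2 ^ 2 + x 3 ^ 2 < 1} → (∀ x ∈ ch.domain, ch.integrand x = 1) → k23.domain = {x : Fin 8 → ℝ | x 2 ^ 2 + x 3 ^ 2 < 1 ∧ x 4 ^ 2 + x 5 ^ 2 < 1 ∧ x 6 ^ 2 + x 7 ^ 2 < 1 ∧ (x 2 - x 0) ^ 2 + (x 3 - x 1) ^ 2 < 1 ∧ (x 4 - x 0) ^ 2 + (x 5 - x 1) ^ 2 < 1 ∧ (x 6 - x 0) ^ 2 + (x 7 - x 1) ^ 2 < 1} → (∀ x ∈ k23.domain, k23.integrand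 x = 1) → gem.domain = {x : Fin 8 → ℝ | x 0 ^ 2 + x 1 ^ 2 < 1 ∧ (x 2 - x 0) ^ 2 + (x 3 - x 1) ^ 2 < 1 ∧ (x 4 - x 2) ^ 2 + (x 5 - x 3) ^ 2 < 1 ∧ (x 6 - x 4) ^ 2 + (x 7 - x 5) ^ 2 < 1 ∧ x 6 ^ 2 + x 7 ^ 2 < 1 ∧ x 2 ^ 2 + x 3 ^ 2 < 1 ∧ x 4 ^ 2 + x 5 ^ 2 < 1} → (∀ x ∈ gem.domain, gem.integrand x = 1) → cr.domain = {x : Fin 8 → ℝ | x 0 ^ 2 + x 1 ^ 2 < 1 ∧ (x 2 - x 0) ^ 2 + (x 3 - x 1) ^ 2 < 1 ∧ (x 4 - x 2) ^ 2 + (x 5 - x 3) ^ 2 < 1 ∧ (x 6 - x 4) ^ 2 + (x 7 - x 5) ^ 2 < 1 ∧ x 6 ^ 2 + x 7 ^ 2 < 1 ∧ x 2 ^ 2 + x 3 ^ 2 < 1 ∧ (x 4 - x 0) ^ 2 + (x 5 - x 1) ^ 2 < 1} → (∀ x ∈ cr.domain, cr.integrand x = 1) → k5t.domain = {x : Fin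 8 → ℝ | x 0 ^ 2 + x 1 ^ 2 < 1 ∧ x 2 ^ 2 + x 3 ^ 2 < 1 ∧ x 4 ^ 2 + x 5 ^ 2 < 1 ∧ x 6 ^ 2 + x 7 ^ 2 < 1 ∧ (x 2 - x 0) ^ 2 + (x 3 - x 1) ^ 2 < 1 ∧ (x 4 - x 0) ^ 2 + (x 5 - x 1) ^ 2 < 1 ∧ (x 6 - x 0) ^ 2 + (x 7 - x 1) ^ 2 < 1} → (∀ x ∈ k5t.domain, k5t.integrand x = 1) → w4.domain = {x : Fin 8 → ℝ | x 0 ^ 2 + x 1 ^ 2 < 1 ∧ x 2 ^ 2 + x 3 ^ 2 < 1 ∧ x 4 ^ 2 + x 5 ^ 2 < 1 ∧ x 6 ^ 2 + x 7 ^ 2 < 1 ∧ (x 2 - x 0) ^ 2 + (x 3 - x 1) ^ 2 < 1 ∧ (x 4 - x 2) ^ 2 + (x 5 - x 3) ^ 2 < 1 ∧ (x 6 - x 4) ^ 2 + (x 7 - x 5) ^ 2 < 1 ∧ (x 6 - x 0) ^ 2 + (x 7 - x 1) ^ 2 < 1} → (∀ x ∈ w4.domain, w4.integrand x = 1) → k5p.domain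 = {x : Fin 8 → ℝ | x 0 ^ 2 + x 1 ^ 2 < 1 ∧ x 2 ^ 2 + x 3 ^ 2 < 1 ∧ x 4 ^ 2 + x 5 ^ 2 < 1 ∧ x 6 ^ 2 + x 7 ^ 2 < 1 ∧ (x 2 - x 0) ^ 2 + (x 3 - x 1) ^ 2 < 1 ∧ (x 4 - x 0) ^ 2 + (x 5 - x 1) ^ 2 < 1 ∧ (x 6 - x 0) ^ 2 + (x 7 - x 1) ^ 2 < 1 ∧ (x 6 - x 2) ^ 2 + (x 7 - x 3) ^ 2 < 1} → (∀ x ∈ k5p.domain, k5p.integrand x = 1) → k5e.domain = {x : Fin 8 → ℝ | x 0 ^ 2 + x 1 ^ 2 < 1 ∧ x 2 ^ 2 + x 3 ^ 2 < 1 ∧ x 4 ^ 2 + x 5 ^ 2 < 1 ∧ x 6 ^ 2 + x 7 ^ 2 < 1 ∧ (x 2 - x 0) ^ 2 + (x 3 - x 1) ^ 2 < 1 ∧ (x 4 - x 0) ^ 2 + (x 5 - x 1) ^ 2 < 1 ∧ (x 6 - x 0) ^ 2 + (x 7 - x 1) ^ 2 < 1 ∧ (x 4 - x 2) ^ 2 +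 (x 5 - x 3) ^ 2 < 1 ∧ (x 6 - x 2) ^ 2 + (x 7 - x 3) ^ 2 < 1} → (∀ x ∈ k5e.domain, k5e.integrand x = 1) → k5.domain = {x : Fin 8 → ℝ | x 0 ^ 2 + x 1 ^ 2 < 1 ∧ x 2 ^ 2 + x 3 ^ 2 < 1 ∧ x 4 ^ 2 + x 5 ^ 2 < 1 ∧ x 6 ^ 2 + x 7 ^ 2 < 1 ∧ (x 2 - x 0) ^ 2 + (x 3 - x 1) ^ 2 < 1 ∧ (x 4 - x 0) ^ 2 + (x 5 - x 1) ^ 2 < 1 ∧ (x 6 - x 0) ^ 2 + (x 7 - x 1) ^ 2 < 1 ∧ (x 4 - x 2) ^ 2 + (x 5 - x 3) ^ 2 < 1 ∧ (x 6 - x 2) ^ 2 + (x 7 - x 3) ^ 2 < 1 ∧ (x 6 - x 4) ^ 2 + (x 7 - x 5) ^ 2 < 1} → (∀ x ∈ k5.domain, k5.integrand x = 1) → ∀ (q₀ q₁ q₂ q₃ : ℚ), -12 * c5.value + 60 * ch.value + 10 * k23.value - 60 * gem.value - 30 * cr.value - 10 * k5t.value + 15 * w4.value + 30 * k5p.value -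 10 * k5e.value + k5.value ≠ (q₀ : ℝ) * Real.pi ^ 4 + (q₁ : ℝ) * Real.sqrt 3 * Real.pi ^ 3 + (q₂ : ℝ) * Real.pi ^ 2 + (q₃ : ℝ) * Real.sqrt 3 * Real.pi

/-- item stmt-KontsevichZagierPeriods-3822 · assembly · rank 1 · closed · proved by Summit.KontsevichZagierPeriods.VolumeFormAssembly.symplecticScissors_assembly_proof (prover) · by planner
sources: ViuSos2021, KontsevichZagier2001
[assembly] VolumeForm → KontsevichZagierPeriods (difference of volumes + slabs + gluing +
soundness). -/
@[route_item "route-KontsevichZagierPeriods-HardSphereVirial", crux]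
def Assembly : Prop :=
  VolumeForm → KontsevichZagierPeriods

-- `Assembly` holds: proved by `Summit.KontsevichZagierPeriods.VolumeFormAssembly.symplecticScissors_assembly_proof` (its module imports this route file, so no `_holds` link can be stated here).

-- records of items no longer active in this route (dropped / restated):
-- earlier TriangleSphere (stmt-KontsevichZagierPeriods-8526, replaced 2026-08-15T16:16:06Z -> stmt-KontsevichZagierPeriods-10460): retired by None — ∀ (r : Literature.NumberTheory.Transcendental.KZ.IntegralRep 6), r.domain = {x | x 0 ^ 2 + x 1 ^ 2 + x 2 ^ 2 < 1 ∧ x 3 ^ 2 + x 4 ^ 2 + x 5 ^ 2 < 1 ∧ (x 0 - x 3) ^ 2 + (x 1 - x 4) ^ 2 + (x 2 - x 5) ^ 2 < 1} → (∀ x ∈ r.domain, r.integrand x = 1) → (6 : ℤ)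

/-! D-0027 §2.1 — DECIDING THEOREM (planner-authored via `route open/edit --closes-file`; by planner-rchoice-KontsevichZagierPeriods-HardSp-cf946b0c-0 2026-08-16T03:28:24Z):
its hypotheses are this route's items and its conclusion the sub-problem Statement (glue_lint), and it elaborates with this file. -/

@[closes "route-KontsevichZagierPeriods-HardSphereVirial"] theorem closes (hK : UnitDistanceKernel) (h2 : StarFourSphere) (h4 : StarFourDisc)
    (h5 : IsotropyFactorisation3) (hA : Assembly) : KontsevichZagierPeriods :=
  hA (fun _ r r' hr hr' hv =>
    hK Literature.NumberTheory.Transcendental.KZ.relations le_rfl h2 h4 h5 r r' hr hr' hv)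

end Summit.KontsevichZagierPeriods.KontsevichZagierPeriods.Theses.HardSphereVirial
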